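import Literature.Analysis.Complex.LoewnerFastTrackLoewnerMatrixSuff
import HarnessLib

/-!
# Loewner's theorem, Part I — step 5: the Bendat–Sherman theorem
# (Hansen 2013, Theorems 3.5–3.7; Hansen–Pedersen 1982, Lemmas 3.7–3.8)

Fifth brick of the hard direction (`→`) of `Literature.Analysis.Complex.loewner_theorem` along
Hansen's fast track [Hansen2013]. Main results:

* `secondDividedDiff_matrix_posSemidef_of_opConvex` — for `f ∈ C²[a, b]` operator convex at level
  `n + 1` and nodes `u, d₁, …, dₙ ∈ (a, b)`, the matrix of second divided differences
  `([u, dᵢ, dⱼ]_f)ᵢⱼ` (a Kraus matrix, Hansen's Theorem 3.5) is positive semidefinite;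
* `dividedDiff_matrixMonotone_of_opConvex` — the smooth interior Bendat–Sherman theorem (Hansen's
  Theorem 3.6): `t ↦ [u, t]_f` is then `n`-monotone on `(a, b)`;
* `exists_smooth_matrixMonotone_approx` — regularisation (Hansen §2.1): an operator monotone
  function on `(0, ∞)` is a pointwise limit of `C^∞` operator monotone functions on `(0, ∞)`;
* `exists_hasDerivAt_dividedDiff_antitone` — the general Bendat–Sherman theorem for operator
  monotone `f` on `(0, ∞)` (Hansen's Theorem 3.7 / Corollary 3.8): `f` is differentiable and
  `t ↦ [t₀, t]_f` is operator monotone decreasing on `(0, ∞)`;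
* `tendsto_deriv_of_concave_of_tendsto`, `loewner_matrix_posSemidef_of_isMatrixMonotoneOn_Ioi`,
  `eq_of_deriv_eq_zero_of_isMatrixMonotoneOn_Ioi` — Hansen's Corollaries 3.8–3.10 (convergence of
  the derivatives of the regularisations, positivity of the Loewner matrices of a general operator
  monotone function, and absence of stationary points for non-constant ones).

Divided differences are used in Hermite–Genocchi (integral) form
`[u, v]_f = ∫₀¹ f'(u + s(v - u)) ds`, `[u, v, w]_f = ∫₀¹∫₀¹ s f''(u + s(v - u) + sρ(w - v)) dρ ds`, which
are defined at confluent nodes without case distinctions. Instead of Hansen's second-order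
expansion of `t ↦ ⟨f(x + th)ξ, ξ⟩` via Kraus matrices and eigenvalue perturbation, we prove an
*exact* mixed-basis second-order remainder formula
`((f(y) - f(x) - Df(x)(y - x))V)ᵢₖ = ∑ⱼ [dᵢ, dⱼ, μₖ]_f (y - x)ᵢⱼ ((y - x)V)ⱼₖ` for `x = diag d`,
`y = V diag(μ) V⋆` (`cfc_sub_cfc_sub_deriv_mul_apply`), take Hansen–Pedersen's special direction
`h = ∑ᵢ (eᵢ₀ + e₀ᵢ)` (their Lemma 3.7), use operator convexity in the form
`ε Df(x)h ≤ f(x + εh) - f(x)`, compress to the indices `≥ 1`, divide by `ε²` and let `ε → 0` using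
the continuity of the matrix functional calculus (`Filter.Tendsto.cfc`). The general case follows
by mollification (Mathlib's `ContDiffBump` convolution API) exactly as in Hansen's proof of
Theorem 3.7, with Hansen's Theorem 2.1 (brick 1) supplying continuity and concavity.
-/

noncomputable section

open scoped ComplexOrder ComplexConjugate MatrixOrder Matrix.Norms.L2Operator
open Complex Set Filter Topology Metric Real Matrix Polynomial

namespace Literature.Analysis.Complex

/-! ## Divided differences in Hermite–Genocchi form (first and second order) -/

section HermiteGenocchi

open MeasureTheory

/-- **First divided difference, Hermite–Genocchi form**:
`(∫₀¹ f'(u + s(v - u)) ds) (v - u) = f(v) - f(u)`. [folklore] -/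
theorem integral_deriv_segment_mul_sub {f f' : ℝ → ℝ} {a b : ℝ}
    (hf : ∀ x ∈ Icc a b, HasDerivAt f (f' x) x) (hf'c : Continuous f') {u v : ℝ}
    (hu : u ∈ Icc a b) (hv : v ∈ Icc a b) :
    (∫ s in (0 : ℝ)..1, f' (u + s * (v - u))) * (v - u) = f v - f u := by
  have hderiv : ∀ s ∈ uIcc (0 : ℝ) 1, HasDerivAt (fun s => f (u + s * (v - u)))
      (f' (u + s * (v - u)) * (v - u)) s := by
    intro s hs
    rw [uIcc_of_le zero_le_one] at hs
    have h1 : HasDerivAt (fun s : ℝ => u + s * (v - u)) (v - u) s := by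
      simpa using ((hasDerivAt_id s).mul_const (v - u)).const_add u
    exact (hf _ ((convex_Icc _ _).add_smul_sub_mem hu hv hs)).comp s h1
  have hint : IntervalIntegrable (fun s => f' (u + s * (v - u)) * (v - u)) volume 0 1 :=
    ((hf'c.comp (by fun_prop)).mul continuous_const).intervalIntegrable _ _
  have h := intervalIntegral.integral_eq_sub_of_hasDerivAt hderiv hint
  simp only [zero_mul, add_zero, one_mul, add_sub_cancel] at h
  rw [← h, intervalIntegral.integral_mul_const]

/-- The Hermite–Genocchi first divided difference is the confluent slope. [folklore] -/
theorem integral_deriv_segment_eq_ite {f f' : ℝ → ℝ} {a b : ℝ}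
    (hf : ∀ x ∈ Icc a b, HasDerivAt f (f' x) x) (hf'c : Continuous f') {u v : ℝ}
    (hu : u ∈ Icc a b) (hv : v ∈ Icc a b) :
    (∫ s in (0 : ℝ)..1, f' (u + s * (v - u))) = if u = v then f' u else slope f u v := by
  split_ifs with huv
  · subst huv; simp
  · have h := integral_deriv_segment_mul_sub hf hf'c hu hv
    rw [slope_def_field, eq_div_iff (sub_ne_zero.2 (Ne.symm huv))]
    exact h

/-- **Second divided difference, Hermite–Genocchi form** (fixed limits):
`D₂(u, v, w) (w - v) = D₁(u, w) - D₁(u, v)` where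
`D₂ = ∫₀¹∫₀¹ s f''(u + s(v - u) + sρ(w - v)) dρ ds`. [folklore] -/
theorem integral2_deriv2_mul_sub {f' f'' : ℝ → ℝ} {a b : ℝ}
    (hf' : ∀ x ∈ Icc a b, HasDerivAt f' (f'' x) x) (hf''c : Continuous f'') {u v w : ℝ}
    (hu : u ∈ Icc a b) (hv : v ∈ Icc a b) (hw : w ∈ Icc a b) :
    (∫ s in (0 : ℝ)..1, ∫ ρ in (0 : ℝ)..1, s * f'' (u + s * (v - u) + s * ρ * (w - v))) * (w - v) =
      (∫ s in (0 : ℝ)..1, f' (u + s * (w - u))) - ∫ s in (0 : ℝ)..1, f' (u + s * (v - u)) := by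
  -- inner fundamental theorem of calculus, for each `s`
  have hinner : ∀ s ∈ Icc (0 : ℝ) 1,
      (∫ ρ in (0 : ℝ)..1, s * f'' (u + s * (v - u) + s * ρ * (w - v))) * (w - v) =
        f' (u + s * (w - u)) - f' (u + s * (v - u)) := by
    intro s hs
    have hcs : u + s * (v - u) ∈ Icc a b := (convex_Icc _ _).add_smul_sub_mem hu hv hs
    have hcw : u + s * (w - u) ∈ Icc a b := (convex_Icc _ _).add_smul_sub_mem hu hw hs
    have hderiv : ∀ ρ ∈ uIcc (0 : ℝ) 1, HasDerivAt (fun ρ => f' (u + s * (v - u) + s * ρ * (w - v)))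
        (f'' (u + s * (v - u) + s * ρ * (w - v)) * (s * (w - v))) ρ := by
      intro ρ hρ
      rw [uIcc_of_le zero_le_one] at hρ
      have hpt : u + s * (v - u) + s * ρ * (w - v) ∈ Icc a b := by
        have e : u + s * (v - u) + s * ρ * (w - v) =
            (u + s * (v - u)) + ρ * ((u + s * (w - u)) - (u + s * (v - u))) := by ring
        rw [e]; exact (convex_Icc _ _).add_smul_sub_mem hcs hcw hρ
      have h1 : HasDerivAt (fun ρ : ℝ => u + s * (v - u) + s * ρ * (w - v)) (s * (w - v)) ρ := by
        have := ((hasDerivAt_id ρ).const_mul s).mul_const (w - v)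
        simpa [mul_assoc] using this.const_add (u + s * (v - u))
      exact (hf' _ hpt).comp ρ h1
    have hint : IntervalIntegrable (fun ρ => f'' (u + s * (v - u) + s * ρ * (w - v)) * (s * (w - v)))
        volume 0 1 := ((hf''c.comp (by fun_prop)).mul continuous_const).intervalIntegrable _ _
    have h := intervalIntegral.integral_eq_sub_of_hasDerivAt hderiv hint
    have e1 : u + s * (v - u) + s * 1 * (w - v) = u + s * (w - u) := by ring
    simp only [mul_zero, zero_mul, add_zero, e1] at h
    rw [← h, ← intervalIntegral.integral_mul_const]
    congr 1; funext ρ; ring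
  -- integrate over `s`
  have hcont2 : Continuous fun s : ℝ => ∫ ρ in (0 : ℝ)..1, s * f'' (u + s * (v - u) + s * ρ * (w - v)) := by
    refine intervalIntegral.continuous_parametric_intervalIntegral_of_continuous' ?_ 0 1
    exact (continuous_fst.mul (hf''c.comp (by fun_prop)))
  rw [← intervalIntegral.integral_mul_const]
  have hlin : ∀ z : ℝ, Continuous fun s : ℝ => u + s * (z - u) := fun z => by fun_prop
  have hint1 : IntervalIntegrable (fun s : ℝ => f' (u + s * (w - u))) volume 0 1 := by
    refine ContinuousOn.intervalIntegrable ?_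
    rw [uIcc_of_le zero_le_one]
    intro s hs
    have h1 : ContinuousAt (fun s : ℝ => u + s * (w - u)) s := (hlin w).continuousAt
    have h2 : ContinuousAt f' (u + s * (w - u)) := (hf' _ ((convex_Icc _ _).add_smul_sub_mem hu hw hs)).continuousAt
    exact (ContinuousAt.comp (g := f') (f := fun s : ℝ => u + s * (w - u)) h2 h1).continuousWithinAt
  have hint2 : IntervalIntegrable (fun s : ℝ => f' (u + s * (v - u))) volume 0 1 := by
    refine ContinuousOn.intervalIntegrable ?_
    rw [uIcc_of_le zero_le_one]
    intro s hs
    have h1 : ContinuousAt (fun s : ℝ => u + s * (v - u)) s := (hlin v).continuousAt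
    have h2 : ContinuousAt f' (u + s * (v - u)) := (hf' _ ((convex_Icc _ _).add_smul_sub_mem hu hv hs)).continuousAt
    exact (ContinuousAt.comp (g := f') (f := fun s : ℝ => u + s * (v - u)) h2 h1).continuousWithinAt
  rw [← intervalIntegral.integral_sub hint1 hint2]
  refine intervalIntegral.integral_congr fun s hs => ?_
  rw [uIcc_of_le zero_le_one] at hs
  exact hinner s hs

end HermiteGenocchi

section HermiteGenocchi2

open MeasureTheory

/-- Bound on the Hermite–Genocchi second divided difference: `|D₂(u, v, w)| ≤ M` when `|f''| ≤ M`
on an interval containing `u, v, w`. [folklore] -/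
theorem abs_integral2_deriv2_le {f'' : ℝ → ℝ} {a b M : ℝ} (hM : ∀ x ∈ Icc a b, |f'' x| ≤ M)
    {u v w : ℝ} (hu : u ∈ Icc a b) (hv : v ∈ Icc a b) (hw : w ∈ Icc a b) :
    |∫ s in (0 : ℝ)..1, ∫ ρ in (0 : ℝ)..1, s * f'' (u + s * (v - u) + s * ρ * (w - v))| ≤ M := by
  have hM0 : 0 ≤ M := (abs_nonneg _).trans (hM u hu)
  have hinner : ∀ s ∈ Icc (0 : ℝ) 1,
      |∫ ρ in (0 : ℝ)..1, s * f'' (u + s * (v - u) + s * ρ * (w - v))| ≤ M := by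
    intro s hs
    have h := intervalIntegral.norm_integral_le_of_norm_le_const (a := (0 : ℝ)) (b := 1) (C := M)
      (f := fun ρ => s * f'' (u + s * (v - u) + s * ρ * (w - v))) (fun ρ hρ => ?_)
    · simpa using h
    · rw [uIoc_of_le zero_le_one] at hρ
      have hρ' : ρ ∈ Icc (0 : ℝ) 1 := ⟨hρ.1.le, hρ.2⟩
      have hpt : u + s * (v - u) + s * ρ * (w - v) ∈ Icc a b := by
        have e : u + s * (v - u) + s * ρ * (w - v) =
            (u + s * (v - u)) + ρ * ((u + s * (w - u)) - (u + s * (v - u))) := by ring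
        rw [e]
        exact (convex_Icc _ _).add_smul_sub_mem ((convex_Icc _ _).add_smul_sub_mem hu hv hs) ((convex_Icc _ _).add_smul_sub_mem hu hw hs) hρ'
      rw [Real.norm_eq_abs, abs_mul, abs_of_nonneg hs.1]
      calc s * |f'' (u + s * (v - u) + s * ρ * (w - v))| ≤ 1 * M := by
            gcongr; exacts [hs.2, hM _ hpt]
        _ = M := one_mul M
  have h := intervalIntegral.norm_integral_le_of_norm_le_const (a := (0 : ℝ)) (b := 1) (C := M)
    (f := fun s => ∫ ρ in (0 : ℝ)..1, s * f'' (u + s * (v - u) + s * ρ * (w - v))) (fun s hs => ?_)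
  · simpa using h
  · rw [uIoc_of_le zero_le_one] at hs
    rw [Real.norm_eq_abs]
    exact hinner s ⟨hs.1.le, hs.2⟩

/-- Continuity of the Hermite–Genocchi second divided difference in its last argument.
[folklore] -/
theorem continuous_integral2_deriv2 {f'' : ℝ → ℝ} (hf''c : Continuous f'') (u v : ℝ) :
    Continuous fun w : ℝ =>
      ∫ s in (0 : ℝ)..1, ∫ ρ in (0 : ℝ)..1, s * f'' (u + s * (v - u) + s * ρ * (w - v)) := by
  have hG : Continuous fun q : ℝ × ℝ =>
      ∫ ρ in (0 : ℝ)..1, q.2 * f'' (u + q.2 * (v - u) + q.2 * ρ * (q.1 - v)) := by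
    refine intervalIntegral.continuous_parametric_intervalIntegral_of_continuous' ?_ 0 1
    show Continuous fun p : (ℝ × ℝ) × ℝ =>
      p.1.2 * f'' (u + p.1.2 * (v - u) + p.1.2 * p.2 * (p.1.1 - v))
    fun_prop
  have h2 : Continuous fun p : ℝ × ℝ =>
      ∫ ρ in (0 : ℝ)..1, p.2 * f'' (u + p.2 * (v - u) + p.2 * ρ * (p.1 - v)) := hG
  exact intervalIntegral.continuous_parametric_intervalIntegral_of_continuous'
    (f := fun w s => ∫ ρ in (0 : ℝ)..1, s * f'' (u + s * (v - u) + s * ρ * (w - v))) h2 0 1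

end HermiteGenocchi2

section SecondOrderRemainder

open MeasureTheory

variable {m : Type*} [Fintype m] [DecidableEq m]

/-- **Exact second-order remainder of a matrix function in mixed coordinates** (a double-operator
-integral identity in finite dimensions): for `x = diag(d)`, `y = V diag(μ) V⋆` (`V` unitary) and
`f ∈ C²` on an interval containing all `dᵢ, μₖ`, with `Df(x)(H)ᵢⱼ = D₁(dᵢ, dⱼ) Hᵢⱼ` (Hermite–Genocchi
first divided differences), one has
`[(f(y) - f(x) - Df(x)(y - x)) V]ᵢₖ = ∑ⱼ D₂(dᵢ, dⱼ, μₖ) (y - x)ᵢⱼ [(y - x)V]ⱼₖ`. [folklore] -/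
theorem cfc_sub_cfc_sub_deriv_mul_apply {f f' f'' : ℝ → ℝ} {a b : ℝ}
    (hf : ∀ x ∈ Icc a b, HasDerivAt f (f' x) x) (hf' : ∀ x ∈ Icc a b, HasDerivAt f' (f'' x) x)
    (hf'c : Continuous f') (hf''c : Continuous f'')
    (d : m → ℝ) (hd : ∀ i, d i ∈ Icc a b) {V : Matrix m m ℂ} (hV : V ∈ Matrix.unitaryGroup m ℂ)
    (μ : m → ℝ) (hμ : ∀ k, μ k ∈ Icc a b) (i k : m) :
    ((cfc f (V * diagonal (fun i => (μ i : ℂ)) * star V) - cfc f (diagonal fun i => (d i : ℂ)) -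
        Matrix.of (fun i j => ((∫ s in (0 : ℝ)..1, f' (d i + s * (d j - d i)) : ℝ) : ℂ) *
          ((V * diagonal (fun i => (μ i : ℂ)) * star V) - diagonal fun i => (d i : ℂ)) i j)) * V) i k =
      ∑ j, ((∫ s in (0 : ℝ)..1, ∫ ρ in (0 : ℝ)..1,
              s * f'' (d i + s * (d j - d i) + s * ρ * (μ k - d j)) : ℝ) : ℂ) *
        ((V * diagonal (fun i => (μ i : ℂ)) * star V) - diagonal fun i => (d i : ℂ)) i j *
        ((((V * diagonal (fun i => (μ i : ℂ)) * star V) - diagonal fun i => (d i : ℂ)) * V) j k) := by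
  set y : Matrix m m ℂ := V * diagonal (fun i => (μ i : ℂ)) * star V with hy
  set x : Matrix m m ℂ := diagonal fun i => (d i : ℂ) with hx
  have h1u : (1 : Matrix m m ℂ) ∈ Matrix.unitaryGroup m ℂ := one_mem _
  -- mixed identities with `U = 1`
  have hA : ((cfc f y - cfc f x) * V) i k = ((f (μ k) - f (d i) : ℝ) : ℂ) * V i k := by
    have h := conjTranspose_mul_cfc_sub_cfc_mul_apply h1u hV d μ f i k
    simp only [star_one, Matrix.one_mul, Matrix.mul_one] at h
    exact h
  have hB : ∀ j, ((y - x) * V) j k = ((μ k - d j : ℝ) : ℂ) * V j k := by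
    intro j
    have h := conjTranspose_mul_sub_mul_apply h1u hV d μ j k
    simp only [star_one, Matrix.one_mul, Matrix.mul_one] at h
    exact h
  -- expand the left-hand side
  rw [Matrix.sub_mul, Matrix.sub_apply, hA, Matrix.mul_apply]
  simp only [Matrix.of_apply]
  -- `f(μₖ) - f(dᵢ) = D₁(dᵢ, μₖ)(μₖ - dᵢ)` and `(μₖ - dᵢ) Vᵢₖ = ((y - x)V)ᵢₖ`
  have hH1 := integral_deriv_segment_mul_sub hf hf'c (hd i) (hμ k)
  have hsum : ((f (μ k) - f (d i) : ℝ) : ℂ) * V i k =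
      ((∫ s in (0 : ℝ)..1, f' (d i + s * (μ k - d i)) : ℝ) : ℂ) * ∑ j, (y - x) i j * V j k := by
    rw [← hH1, ofReal_mul, mul_assoc, ← hB i, Matrix.mul_apply]
  rw [hsum, Finset.mul_sum, ← Finset.sum_sub_distrib]
  refine Finset.sum_congr rfl fun j _ => ?_
  -- `D₁(dᵢ, μₖ) - D₁(dᵢ, dⱼ) = D₂(dᵢ, dⱼ, μₖ)(μₖ - dⱼ)` and `(μₖ - dⱼ) Vⱼₖ = ((y - x)V)ⱼₖ`
  have hH2 := integral2_deriv2_mul_sub hf' hf''c (hd i) (hd j) (hμ k)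
  rw [hB j]
  have e : ((∫ s in (0 : ℝ)..1, f' (d i + s * (μ k - d i)) : ℝ) : ℂ) * ((y - x) i j * V j k) -
      ((∫ s in (0 : ℝ)..1, f' (d i + s * (d j - d i)) : ℝ) : ℂ) * (y - x) i j * V j k =
      (((∫ s in (0 : ℝ)..1, f' (d i + s * (μ k - d i))) - ∫ s in (0 : ℝ)..1, f' (d i + s * (d j - d i)) : ℝ) : ℂ) *
        (y - x) i j * V j k := by
    push_cast; ring
  rw [e, ← hH2]
  push_cast
  ring

end SecondOrderRemainder

section SecondOrderRemainder2

open MeasureTheory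

variable {m : Type*} [Fintype m] [DecidableEq m]

/-- **Quadratic bound for the second-order remainder**: for `x = diag(d)` and Hermitian `y`, both
with spectra in `[a, b]` where `|f''| ≤ M`,
`|(f(y) - f(x) - Df(x)(y - x))ₐᵦ| ≤ (card m) M (∑ⱼₗ |(y - x)ⱼₗ|)²`. [folklore] -/
theorem norm_cfc_sub_cfc_sub_deriv_apply_le {f f' f'' : ℝ → ℝ} {a b M : ℝ}
    (hf : ∀ x ∈ Icc a b, HasDerivAt f (f' x) x) (hf' : ∀ x ∈ Icc a b, HasDerivAt f' (f'' x) x)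
    (hf'c : Continuous f') (hf''c : Continuous f'') (hM : ∀ x ∈ Icc a b, |f'' x| ≤ M)
    (d : m → ℝ) (hd : ∀ i, d i ∈ Icc a b) {y : Matrix m m ℂ} (hy : y.IsHermitian)
    (hys : spectrum ℝ y ⊆ Icc a b) (i₀ j₀ : m) :
    ‖(cfc f y - cfc f (diagonal fun i => (d i : ℂ)) -
        Matrix.of (fun i j => ((∫ s in (0 : ℝ)..1, f' (d i + s * (d j - d i)) : ℝ) : ℂ) *
          (y - diagonal fun i => (d i : ℂ)) i j)) i₀ j₀‖ ≤
      (Fintype.card m : ℝ) * M * (∑ j, ∑ l, ‖(y - diagonal fun i => (d i : ℂ)) j l‖) ^ 2 := by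
  set x : Matrix m m ℂ := diagonal fun i => (d i : ℂ) with hx
  set V : Matrix m m ℂ := ((hy.eigenvectorUnitary : Matrix.unitaryGroup m ℂ) : Matrix m m ℂ) with hV
  have hVu : V ∈ Matrix.unitaryGroup m ℂ := hy.eigenvectorUnitary.2
  set μ : m → ℝ := hy.eigenvalues with hμ
  have hydec : y = V * diagonal (fun i => (μ i : ℂ)) * star V := by
    have := hy.spectral_theorem
    rw [Unitary.conjStarAlgAut_apply] at this
    exact this
  have hμJ : ∀ k, μ k ∈ Icc a b := fun k => hys (hy.eigenvalues_mem_spectrum_real k)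
  set R : Matrix m m ℂ := cfc f y - cfc f x -
    Matrix.of (fun i j => ((∫ s in (0 : ℝ)..1, f' (d i + s * (d j - d i)) : ℝ) : ℂ) * (y - x) i j) with hR
  set S : ℝ := ∑ j, ∑ l, ‖(y - x) j l‖ with hS
  have hS0 : 0 ≤ S := Finset.sum_nonneg fun j _ => Finset.sum_nonneg fun l _ => norm_nonneg _
  have hM0 : 0 ≤ M := (abs_nonneg _).trans (hM _ (hd i₀))
  -- entries of `R V`
  have hRV : ∀ i k, ‖(R * V) i k‖ ≤ M * S ^ 2 := by
    intro i k
    have h := cfc_sub_cfc_sub_deriv_mul_apply hf hf' hf'c hf''c d hd hVu μ hμJ i k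
    rw [← hydec] at h
    rw [hR, h]
    refine (norm_sum_le _ _).trans ?_
    have hterm : ∀ j, ‖((∫ s in (0 : ℝ)..1, ∫ ρ in (0 : ℝ)..1,
        s * f'' (d i + s * (d j - d i) + s * ρ * (μ k - d j)) : ℝ) : ℂ) * (y - x) i j *
          ((y - x) * V) j k‖ ≤ M * ‖(y - x) i j‖ * S := by
      intro j
      rw [norm_mul, norm_mul, Complex.norm_real, Real.norm_eq_abs]
      have h1 := abs_integral2_deriv2_le hM (hd i) (hd j) (hμJ k)
      have h2 : ‖((y - x) * V) j k‖ ≤ S := by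
        rw [Matrix.mul_apply]
        refine (norm_sum_le _ _).trans ?_
        calc ∑ l, ‖(y - x) j l * V l k‖ ≤ ∑ l, ‖(y - x) j l‖ := Finset.sum_le_sum fun l _ => by
              rw [norm_mul]
              calc ‖(y - x) j l‖ * ‖V l k‖ ≤ ‖(y - x) j l‖ * 1 := by
                    gcongr; exact entry_norm_bound_of_unitary hVu l k
                _ = ‖(y - x) j l‖ := mul_one _
          _ ≤ S := by
              rw [hS]
              exact Finset.single_le_sum (f := fun j => ∑ l, ‖(y - x) j l‖)
                (fun j _ => Finset.sum_nonneg fun l _ => norm_nonneg _) (Finset.mem_univ j)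
      gcongr
    calc ∑ j, ‖((∫ s in (0 : ℝ)..1, ∫ ρ in (0 : ℝ)..1,
          s * f'' (d i + s * (d j - d i) + s * ρ * (μ k - d j)) : ℝ) : ℂ) * (y - x) i j *
            ((y - x) * V) j k‖
        ≤ ∑ j, M * ‖(y - x) i j‖ * S := Finset.sum_le_sum fun j _ => hterm j
      _ = M * S * ∑ j, ‖(y - x) i j‖ := by rw [Finset.mul_sum]; refine Finset.sum_congr rfl fun j _ => by ring
      _ ≤ M * S * S := by
          gcongr
          rw [hS]
          exact Finset.single_le_sum (f := fun j => ∑ l, ‖(y - x) j l‖)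
            (fun j _ => Finset.sum_nonneg fun l _ => norm_nonneg _) (Finset.mem_univ i)
      _ = M * S ^ 2 := by ring
  -- back to `R = (R V) V⋆`
  have hVV : V * star V = 1 := Matrix.mem_unitaryGroup_iff.mp hVu
  have hRRV : R = R * V * star V := by rw [Matrix.mul_assoc, hVV, Matrix.mul_one]
  rw [hRRV, Matrix.mul_apply]
  refine (norm_sum_le _ _).trans ?_
  calc ∑ k, ‖(R * V) i₀ k * (star V) k j₀‖ ≤ ∑ k : m, M * S ^ 2 := Finset.sum_le_sum fun k _ => by
        rw [norm_mul]
        have h1 : ‖(star V) k j₀‖ ≤ 1 := by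
          rw [star_eq_conjTranspose, conjTranspose_apply, norm_star]
          exact entry_norm_bound_of_unitary hVu j₀ k
        calc ‖(R * V) i₀ k‖ * ‖(star V) k j₀‖ ≤ M * S ^ 2 * 1 :=
              mul_le_mul (hRV i₀ k) h1 (norm_nonneg _) (mul_nonneg hM0 (sq_nonneg _))
          _ = M * S ^ 2 := mul_one _
    _ = (Fintype.card m : ℝ) * M * S ^ 2 := by
        rw [Finset.sum_const, Finset.card_univ, nsmul_eq_mul]; ring

end SecondOrderRemainder2

section DividedDifferenceSymmetry

open MeasureTheory

/-- Symmetry of the Hermite–Genocchi first divided difference (substitute `s ↦ 1 - s`).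
[folklore] -/
theorem integral_deriv_segment_symm (f' : ℝ → ℝ) (u v : ℝ) :
    (∫ s in (0 : ℝ)..1, f' (u + s * (v - u))) = ∫ s in (0 : ℝ)..1, f' (v + s * (u - v)) := by
  have h := intervalIntegral.integral_comp_sub_left (fun s => f' (v + s * (u - v))) (a := 0) (b := 1) 1
  simp only [sub_self, sub_zero] at h
  rw [← h]
  refine intervalIntegral.integral_congr fun s _ => ?_
  show f' (u + s * (v - u)) = f' (v + (1 - s) * (u - v))
  congr 1; ring

/-- Slope algebra behind the symmetry of second divided differences at distinct nodes:
`([u,w] - [u,v])/(w - v) = ([v,w] - [v,u])/(w - u)`. [folklore] -/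
theorem slope_sub_slope_div_eq (f : ℝ → ℝ) {u v w : ℝ} (huv : u ≠ v) (huw : u ≠ w) (hvw : v ≠ w) :
    (slope f u w - slope f u v) / (w - v) = (slope f v w - slope f v u) / (w - u) := by
  simp only [slope_def_field]
  rw [div_eq_div_iff (sub_ne_zero.2 (Ne.symm hvw)) (sub_ne_zero.2 (Ne.symm huw))]
  field_simp [sub_ne_zero.2 (Ne.symm huw), sub_ne_zero.2 (Ne.symm huv), sub_ne_zero.2 huv,
    sub_ne_zero.2 (Ne.symm hvw)]
  ring

/-- **Symmetry of the Hermite–Genocchi second divided difference in its first two arguments.**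
At distinct nodes both sides are the classical symmetric expression; coincidences follow by
continuity in the last argument. [folklore] -/
theorem integral2_deriv2_swap {f f' f'' : ℝ → ℝ} {a b : ℝ}
    (hf : ∀ x ∈ Icc a b, HasDerivAt f (f' x) x) (hf' : ∀ x ∈ Icc a b, HasDerivAt f' (f'' x) x)
    (hf'c : Continuous f') (hf''c : Continuous f'') {u v : ℝ} (hu : u ∈ Ioo a b) (hv : v ∈ Ioo a b)
    {w : ℝ} (hw : w ∈ Ioo a b) :
    (∫ s in (0 : ℝ)..1, ∫ ρ in (0 : ℝ)..1, s * f'' (u + s * (v - u) + s * ρ * (w - v))) =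
      ∫ s in (0 : ℝ)..1, ∫ ρ in (0 : ℝ)..1, s * f'' (v + s * (u - v) + s * ρ * (w - u)) := by
  rcases eq_or_ne u v with huv | huv
  · subst huv; rfl
  -- the identity at `w ∉ {u, v}` inside `(a, b)`
  have hkey : ∀ w ∈ Ioo a b, w ≠ u → w ≠ v →
      (∫ s in (0 : ℝ)..1, ∫ ρ in (0 : ℝ)..1, s * f'' (u + s * (v - u) + s * ρ * (w - v))) =
        ∫ s in (0 : ℝ)..1, ∫ ρ in (0 : ℝ)..1, s * f'' (v + s * (u - v) + s * ρ * (w - u)) := by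
    intro w hw hwu hwv
    have hu' := Ioo_subset_Icc_self hu
    have hv' := Ioo_subset_Icc_self hv
    have hw' := Ioo_subset_Icc_self hw
    have h1 := integral2_deriv2_mul_sub hf' hf''c hu' hv' hw'
    have h2 := integral2_deriv2_mul_sub hf' hf''c hv' hu' hw'
    rw [integral_deriv_segment_eq_ite hf hf'c hu' hw', integral_deriv_segment_eq_ite hf hf'c hu' hv',
      if_neg (Ne.symm hwu), if_neg huv] at h1
    rw [integral_deriv_segment_eq_ite hf hf'c hv' hw', integral_deriv_segment_eq_ite hf hf'c hv' hu',
      if_neg (Ne.symm hwv), if_neg (Ne.symm huv)] at h2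
    have e1 := (eq_div_iff (sub_ne_zero.2 hwv)).mpr h1
    have e2 := (eq_div_iff (sub_ne_zero.2 hwu)).mpr h2
    rw [e1, e2]
    exact slope_sub_slope_div_eq f huv (Ne.symm hwu) (Ne.symm hwv)
  -- extend over the coincidences by continuity in `w`
  have hc1 := continuous_integral2_deriv2 hf''c u v
  have hc2 := continuous_integral2_deriv2 hf''c v u
  -- approach `w` from the right by points of `(a, b) ∖ {u, v}`
  set c : ℝ := (b - w) / 2 with hc
  have hcpos : 0 < c := by rw [hc]; linarith [hw.2]
  set z : ℕ → ℝ := fun k => w + c / ((k : ℝ) + 2) with hz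
  have hz_gt : ∀ k, w < z k := fun k => by
    rw [hz]; dsimp only
    have : 0 < c / ((k : ℝ) + 2) := by positivity
    linarith
  have hz_mem : ∀ k, z k ∈ Ioo a b := by
    intro k
    refine ⟨hw.1.trans (hz_gt k), ?_⟩
    rw [hz]; dsimp only
    have hk : (0 : ℝ) ≤ k := Nat.cast_nonneg k
    have h1 : c / ((k : ℝ) + 2) ≤ c / 2 := div_le_div_of_nonneg_left hcpos.le (by norm_num) (by linarith)
    rw [hc] at h1 ⊢
    linarith [hw.2]
  have hz_lim : Tendsto z atTop (𝓝 w) := by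
    have h1 : Tendsto (fun k : ℕ => c / ((k : ℝ) + 2)) atTop (𝓝 0) :=
      tendsto_const_nhds.div_atTop (tendsto_atTop_add_const_right _ 2 tendsto_natCast_atTop_atTop)
    simpa [hz] using tendsto_const_nhds.add h1
  have hev : ∀ t : ℝ, ∀ᶠ k in atTop, z k ≠ t := by
    intro t
    rcases le_or_gt t w with htw | htw
    · exact Eventually.of_forall fun k => (ne_of_gt (htw.trans_lt (hz_gt k)))
    · exact ((tendsto_order.1 hz_lim).2 t htw).mono fun k hk => ne_of_lt hk
  have heq : ∀ᶠ k in atTop,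
      (fun k => ∫ s in (0 : ℝ)..1, ∫ ρ in (0 : ℝ)..1, s * f'' (u + s * (v - u) + s * ρ * (z k - v))) k =
        (fun k => ∫ s in (0 : ℝ)..1, ∫ ρ in (0 : ℝ)..1, s * f'' (v + s * (u - v) + s * ρ * (z k - u))) k := by
    filter_upwards [hev u, hev v] with k hku hkv
    exact hkey (z k) (hz_mem k) hku hkv
  exact tendsto_nhds_unique_of_eventuallyEq ((hc1.tendsto w).comp hz_lim) ((hc2.tendsto w).comp hz_lim) heq

end DividedDifferenceSymmetry

section DividedDifferenceCalculus

open MeasureTheory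

/-- Joint continuity of the Hermite–Genocchi second divided difference in its last two arguments.
[folklore] -/
theorem continuous_integral2_deriv2_pair {f'' : ℝ → ℝ} (hf''c : Continuous f'') (u : ℝ) :
    Continuous fun p : ℝ × ℝ =>
      ∫ s in (0 : ℝ)..1, ∫ ρ in (0 : ℝ)..1, s * f'' (u + s * (p.1 - u) + s * ρ * (p.2 - p.1)) := by
  have hG : Continuous fun q : (ℝ × ℝ) × ℝ =>
      ∫ ρ in (0 : ℝ)..1, q.2 * f'' (u + q.2 * (q.1.1 - u) + q.2 * ρ * (q.1.2 - q.1.1)) := by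
    refine intervalIntegral.continuous_parametric_intervalIntegral_of_continuous' ?_ 0 1
    show Continuous fun p : ((ℝ × ℝ) × ℝ) × ℝ =>
      p.1.2 * f'' (u + p.1.2 * (p.1.1.1 - u) + p.1.2 * p.2 * (p.1.1.2 - p.1.1.1))
    fun_prop
  exact intervalIntegral.continuous_parametric_intervalIntegral_of_continuous'
    (f := fun (p : ℝ × ℝ) s => ∫ ρ in (0 : ℝ)..1, s * f'' (u + s * (p.1 - u) + s * ρ * (p.2 - p.1))) hG 0 1

/-- **The divided-difference function is differentiable, with derivative the confluent second
divided difference**: `d/dt D₁(u, t) = D₂(u, t, t)` on `(a, b)`. [folklore] -/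
theorem hasDerivAt_integral_deriv_segment {f' f'' : ℝ → ℝ} {a b : ℝ}
    (hf' : ∀ x ∈ Icc a b, HasDerivAt f' (f'' x) x) (hf''c : Continuous f'') {u : ℝ} (hu : u ∈ Ioo a b)
    {t : ℝ} (ht : t ∈ Ioo a b) :
    HasDerivAt (fun t => ∫ s in (0 : ℝ)..1, f' (u + s * (t - u)))
      (∫ s in (0 : ℝ)..1, ∫ ρ in (0 : ℝ)..1, s * f'' (u + s * (t - u) + s * ρ * (t - t))) t := by
  rw [hasDerivAt_iff_tendsto_slope]
  have hu' := Ioo_subset_Icc_self hu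
  -- the slope is a second divided difference
  have hslope : ∀ w ∈ Ioo a b, w ≠ t →
      slope (fun t => ∫ s in (0 : ℝ)..1, f' (u + s * (t - u))) t w =
        ∫ s in (0 : ℝ)..1, ∫ ρ in (0 : ℝ)..1, s * f'' (u + s * (t - u) + s * ρ * (w - t)) := by
    intro w hw hwt
    have h := integral2_deriv2_mul_sub hf' hf''c hu' (Ioo_subset_Icc_self ht) (Ioo_subset_Icc_self hw)
    rw [slope_def_field, ← h, mul_div_assoc, div_self (sub_ne_zero.2 hwt), mul_one]
  have hcont := (continuous_integral2_deriv2 hf''c u t).tendsto t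
  refine ((hcont.mono_left nhdsWithin_le_nhds).congr' ?_)
  have hmem : ∀ᶠ w in 𝓝[≠] t, w ∈ Ioo a b ∧ w ≠ t := by
    have h1 : ∀ᶠ w in 𝓝[≠] t, w ∈ Ioo a b :=
      mem_nhdsWithin_of_mem_nhds (isOpen_Ioo.mem_nhds ht)
    filter_upwards [h1, self_mem_nhdsWithin] with w hw hwt
    exact ⟨hw, hwt⟩
  filter_upwards [hmem] with w hw
  exact (hslope w hw.1 hw.2).symm

end DividedDifferenceCalculus

section HPSpecialDirection

variable {n : ℕ}

/-- Hansen–Pedersen's perturbation direction `h = ∑ᵢ (eᵢ₀ + e₀ᵢ)` (Hansen–Pedersen 1982,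
Lemma 3.7): Hermitian, and `-(n+1) ≤ h ≤ n+1`. [folklore] -/
theorem hp_direction_bounds :
    (Matrix.of fun a c : Fin (n + 1) =>
        (if a = 0 then (if c = 0 then (0 : ℂ) else 1) else (if c = 0 then 1 else 0))).IsHermitian ∧
      ((((n + 1 : ℕ) : ℝ) : ℂ) • (1 : Matrix (Fin (n + 1)) (Fin (n + 1)) ℂ) -
        Matrix.of fun a c : Fin (n + 1) =>
          (if a = 0 then (if c = 0 then (0 : ℂ) else 1) else (if c = 0 then 1 else 0))).PosSemidef ∧
      ((((n + 1 : ℕ) : ℝ) : ℂ) • (1 : Matrix (Fin (n + 1)) (Fin (n + 1)) ℂ) +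
        Matrix.of fun a c : Fin (n + 1) =>
          (if a = 0 then (if c = 0 then (0 : ℂ) else 1) else (if c = 0 then 1 else 0))).PosSemidef := by
  set h : Matrix (Fin (n + 1)) (Fin (n + 1)) ℂ := Matrix.of fun a c : Fin (n + 1) =>
    (if a = 0 then (if c = 0 then (0 : ℂ) else 1) else (if c = 0 then 1 else 0)) with hh
  have hherm : h.IsHermitian := by
    unfold Matrix.IsHermitian
    ext a c
    simp only [hh, conjTranspose_apply, Matrix.of_apply]
    by_cases ha : a = 0 <;> by_cases hc : c = 0 <;> simp [ha, hc]
  have h1h : ((((n + 1 : ℕ) : ℝ) : ℂ) • (1 : Matrix (Fin (n + 1)) (Fin (n + 1)) ℂ)).IsHermitian := by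
    unfold Matrix.IsHermitian; rw [conjTranspose_smul, conjTranspose_one]; simp
  -- the quadratic form of `h`
  have hq : ∀ v : Fin (n + 1) → ℂ, star v ⬝ᵥ (h *ᵥ v) =
      star (v 0) * (∑ i : Fin n, v i.succ) + star (∑ i : Fin n, v i.succ) * v 0 := by
    intro v
    simp only [dotProduct, mulVec, hh, Matrix.of_apply, Fin.sum_univ_succ, Fin.succ_ne_zero, if_true,
      if_false, Pi.star_apply, zero_mul, zero_add, star_sum, Finset.sum_mul]
    simp
  -- the bound `|ξ⋆ h ξ| ≤ (n+1) ‖ξ‖²` in real parts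
  have hbound : ∀ v : Fin (n + 1) → ℂ,
      |(star v ⬝ᵥ (h *ᵥ v)).re| ≤ ((n + 1 : ℕ) : ℝ) * (star v ⬝ᵥ v).re := by
    intro v
    rw [hq]
    set S : ℂ := ∑ i : Fin n, v i.succ with hS
    have hvv : (star v ⬝ᵥ v).re = ‖v 0‖ ^ 2 + ∑ i : Fin n, ‖v i.succ‖ ^ 2 := by
      simp only [dotProduct, Pi.star_apply, Fin.sum_univ_succ, add_re, re_sum]
      congr 1
      · rw [Complex.star_def, ← Complex.normSq_eq_conj_mul_self, ofReal_re, Complex.normSq_eq_norm_sq]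
      · refine Finset.sum_congr rfl fun i _ => ?_
        rw [Complex.star_def, ← Complex.normSq_eq_conj_mul_self, ofReal_re, Complex.normSq_eq_norm_sq]
    rw [hvv]
    have h2 : (star (v 0) * S + star S * v 0).re = 2 * (star (v 0) * S).re := by
      have : star S * v 0 = star (star (v 0) * S) := by rw [star_mul, star_star]
      rw [add_re, this, Complex.star_def, Complex.conj_re]; ring
    rw [h2]
    have h3 : |2 * (star (v 0) * S).re| ≤ 2 * (‖v 0‖ * ‖S‖) := by
      rw [abs_mul, abs_two]
      gcongr
      exact (Complex.abs_re_le_norm _).trans (by rw [norm_mul, norm_star])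
    have h4 : ‖S‖ ^ 2 ≤ (n : ℝ) * ∑ i : Fin n, ‖v i.succ‖ ^ 2 := by
      calc ‖S‖ ^ 2 ≤ (∑ i : Fin n, ‖v i.succ‖) ^ 2 := by
            gcongr; exact norm_sum_le _ _
        _ ≤ (Finset.univ.card : ℝ) * ∑ i : Fin n, ‖v i.succ‖ ^ 2 := by
            have := sq_sum_le_card_mul_sum_sq (s := (Finset.univ : Finset (Fin n))) (f := fun i => ‖v i.succ‖)
            exact_mod_cast this
        _ = (n : ℝ) * ∑ i : Fin n, ‖v i.succ‖ ^ 2 := by rw [Finset.card_univ, Fintype.card_fin]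
    have h5 : 2 * (‖v 0‖ * ‖S‖) ≤ ‖v 0‖ ^ 2 + ‖S‖ ^ 2 := by
      have := two_mul_le_add_sq ‖v 0‖ ‖S‖; linarith
    have hsum0 : 0 ≤ ∑ i : Fin n, ‖v i.succ‖ ^ 2 := Finset.sum_nonneg fun i _ => sq_nonneg _
    push_cast
    nlinarith [h3, h4, h5, sq_nonneg ‖v 0‖, hsum0]
  refine ⟨hherm, ?_, ?_⟩
  · refine posSemidef_of_re_star_dotProduct_mulVec_nonneg (h1h.sub hherm) fun v => ?_
    rw [sub_mulVec, dotProduct_sub, sub_re, Matrix.smul_mulVec, one_mulVec, dotProduct_smul, smul_eq_mul,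
      re_ofReal_mul]
    have := hbound v
    rw [abs_le] at this
    linarith [this.2]
  · refine posSemidef_of_re_star_dotProduct_mulVec_nonneg (h1h.add hherm) fun v => ?_
    rw [add_mulVec, dotProduct_add, add_re, Matrix.smul_mulVec, one_mulVec, dotProduct_smul, smul_eq_mul,
      re_ofReal_mul]
    have := hbound v
    rw [abs_le] at this
    linarith [this.1]

end HPSpecialDirection

section RemainderPSD

open MeasureTheory

variable {m : Type*} [Fintype m] [DecidableEq m]

omit [DecidableEq m] in
/-- Positive semidefiniteness passes to entrywise limits. [folklore] -/
theorem posSemidef_of_tendsto_entry {M : ℕ → Matrix m m ℂ} (hM : ∀ k, (M k).PosSemidef)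
    {L : Matrix m m ℂ} (h : ∀ i j, Tendsto (fun k => M k i j) atTop (𝓝 (L i j))) : L.PosSemidef := by
  have hherm : L.IsHermitian := by
    unfold Matrix.IsHermitian
    ext i j
    rw [conjTranspose_apply]
    have h1 : Tendsto (fun k => star (M k j i)) atTop (𝓝 (star (L j i))) :=
      (continuous_star.tendsto _).comp (h j i)
    have h2 : (fun k => star (M k j i)) = fun k => M k i j := by
      funext k
      have := (hM k).1
      unfold Matrix.IsHermitian at this
      rw [← conjTranspose_apply, this]
    rw [h2] at h1
    exact tendsto_nhds_unique h1 (h i j)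
  refine posSemidef_of_re_star_dotProduct_mulVec_nonneg hherm fun ξ => ?_
  have hlim := (continuous_re.tendsto _).comp (tendsto_star_dotProduct_mulVec (l := atTop) h ξ)
  exact ge_of_tendsto' hlim fun k => (Complex.le_def.mp ((hM k).dotProduct_mulVec_nonneg ξ)).1

/-- **Convexity makes the second-order remainder nonnegative** (Hansen–Pedersen 1982, first step
of Lemma 3.8): if `f ∈ C²[a, b]` is operator convex on Hermitian matrices with spectra in `[a, b]`
(convex combinations of any two), `x = diag(e)` with `eₐ ∈ [a, b]`, and `x + τh` has spectrum in
`[a, b]` for `0 ≤ τ ≤ ε`, then `ε Df(x)(h) ≤ f(x + εh) - f(x)`: the convexity inequality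
`f(x + δεh) ≤ (1 - δ) f(x) + δ f(x + εh)` divided by `δ → 0⁺`, using the quadratic remainder
bound for the first-order expansion. [folklore] -/
theorem posSemidef_cfc_add_sub_cfc_sub_deriv {f f' f'' : ℝ → ℝ} {a b : ℝ}
    (hf : ∀ x ∈ Icc a b, HasDerivAt f (f' x) x) (hf' : ∀ x ∈ Icc a b, HasDerivAt f' (f'' x) x)
    (hf'c : Continuous f') (hf''c : Continuous f'')
    (hconv : ∀ X Y : Matrix m m ℂ, X.IsHermitian → Y.IsHermitian →
      spectrum ℝ X ⊆ Icc a b → spectrum ℝ Y ⊆ Icc a b → ∀ s : ℝ, 0 ≤ s → s ≤ 1 →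
        ((s : ℂ) • cfc f X + ((1 - s : ℝ) : ℂ) • cfc f Y -
          cfc f ((s : ℂ) • X + ((1 - s : ℝ) : ℂ) • Y)).PosSemidef)
    (e : m → ℝ) (he : ∀ i, e i ∈ Icc a b) {h : Matrix m m ℂ} (hh : h.IsHermitian) {ε : ℝ} (hε : 0 < ε)
    (hsp : ∀ τ ∈ Icc (0 : ℝ) ε, spectrum ℝ ((diagonal fun i => (e i : ℂ)) + (τ : ℂ) • h) ⊆ Icc a b) :
    (cfc f ((diagonal fun i => (e i : ℂ)) + (ε : ℂ) • h) - cfc f (diagonal fun i => (e i : ℂ)) -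
      (ε : ℂ) • Matrix.of (fun i j => ((∫ s in (0 : ℝ)..1, f' (e i + s * (e j - e i)) : ℝ) : ℂ) * h i j)).PosSemidef := by
  set x : Matrix m m ℂ := diagonal fun i => (e i : ℂ) with hx
  set D : Matrix m m ℂ := Matrix.of (fun i j => ((∫ s in (0 : ℝ)..1, f' (e i + s * (e j - e i)) : ℝ) : ℂ) * h i j) with hD
  have hxh : x.IsHermitian := by
    rw [hx, Matrix.IsHermitian, diagonal_conjTranspose]; congr 1; funext i; simp
  have hyh : ∀ τ : ℝ, (x + (τ : ℂ) • h).IsHermitian := fun τ => by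
    refine hxh.add ?_
    unfold Matrix.IsHermitian; rw [conjTranspose_smul, hh.eq]; simp
  have hxs : spectrum ℝ x ⊆ Icc a b := by simpa using hsp 0 ⟨le_rfl, hε.le⟩
  -- a bound for `f''` on `[a, b]`
  obtain ⟨M, hM⟩ : ∃ M, ∀ t ∈ Icc a b, |f'' t| ≤ M := by
    obtain ⟨M, hM⟩ := isCompact_Icc.exists_bound_of_continuousOn (hf''c.continuousOn (s := Icc a b))
    exact ⟨M, fun t ht => by simpa [Real.norm_eq_abs] using hM t ht⟩
  -- the approximants `N_k = f(x + εh) - f(x) - δ⁻¹ (f(x + δεh) - f(x))`, `δ = 1/(k+2)`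
  set δ : ℕ → ℝ := fun k => 1 / ((k : ℝ) + 2) with hδ
  have hδpos : ∀ k, 0 < δ k := fun k => by rw [hδ]; positivity
  have hδlt : ∀ k, δ k < 1 := fun k => by
    rw [hδ]; dsimp only; rw [div_lt_one (by positivity)]
    have hk : (0 : ℝ) ≤ k := Nat.cast_nonneg k
    linarith
  have hδlim : Tendsto δ atTop (𝓝 0) := by
    rw [hδ]
    exact tendsto_const_nhds.div_atTop (tendsto_atTop_add_const_right _ 2 tendsto_natCast_atTop_atTop)
  set N : ℕ → Matrix m m ℂ := fun k =>
    cfc f (x + (ε : ℂ) • h) - cfc f x - ((δ k)⁻¹ : ℂ) • (cfc f (x + ((δ k * ε : ℝ) : ℂ) • h) - cfc f x) with hN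
  -- each `N k` is positive semidefinite (convexity)
  have hNpsd : ∀ k, (N k).PosSemidef := by
    intro k
    have hmem : δ k * ε ∈ Icc (0 : ℝ) ε :=
      ⟨by positivity, by nlinarith [hδlt k, hε, hδpos k]⟩
    have hc := hconv (x + (ε : ℂ) • h) x (hyh ε) hxh (hsp ε ⟨hε.le, le_rfl⟩) hxs (δ k) (hδpos k).le
      (hδlt k).le
    have hcomb : ((δ k : ℂ)) • (x + (ε : ℂ) • h) + ((1 - δ k : ℝ) : ℂ) • x =
        x + ((δ k * ε : ℝ) : ℂ) • h := by
      push_cast; module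
    rw [hcomb] at hc
    have hsmul := hc.smul (a := (δ k)⁻¹) (inv_pos.2 (hδpos k)).le
    have e : (δ k)⁻¹ • ((δ k : ℂ) • cfc f (x + (ε : ℂ) • h) + ((1 - δ k : ℝ) : ℂ) • cfc f x -
        cfc f (x + ((δ k * ε : ℝ) : ℂ) • h)) = N k := by
      rw [hN]; dsimp only
      have hne : (δ k : ℂ) ≠ 0 := ofReal_ne_zero.2 (hδpos k).ne'
      rw [show ((δ k)⁻¹ : ℝ) • ((δ k : ℂ) • cfc f (x + (ε : ℂ) • h) + ((1 - δ k : ℝ) : ℂ) • cfc f x -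
          cfc f (x + ((δ k * ε : ℝ) : ℂ) • h)) = (((δ k)⁻¹ : ℝ) : ℂ) • ((δ k : ℂ) • cfc f (x + (ε : ℂ) • h) +
            ((1 - δ k : ℝ) : ℂ) • cfc f x - cfc f (x + ((δ k * ε : ℝ) : ℂ) • h)) from rfl]
      push_cast
      rw [smul_sub, smul_add, smul_smul, smul_smul, inv_mul_cancel₀ hne, one_smul]
      rw [show ((δ k : ℂ))⁻¹ * (1 - (δ k : ℂ)) = ((δ k : ℂ))⁻¹ - 1 by field_simp]
      module
    rw [e] at hsmul
    exact hsmul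
  -- entrywise convergence `N k → f(x + εh) - f(x) - εD`
  have hconvN : ∀ i j, Tendsto (fun k => N k i j) atTop
      (𝓝 ((cfc f (x + (ε : ℂ) • h) - cfc f x - (ε : ℂ) • D) i j)) := by
    intro i j
    -- the remainder at step `τ = δ k ε`
    have hrem : ∀ k, ‖(cfc f (x + ((δ k * ε : ℝ) : ℂ) • h) - cfc f x - ((δ k * ε : ℝ) : ℂ) • D) i j‖ ≤
        (Fintype.card m : ℝ) * M * (∑ j', ∑ l, ‖(((δ k * ε : ℝ) : ℂ) • h) j' l‖) ^ 2 := by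
      intro k
      have hb := norm_cfc_sub_cfc_sub_deriv_apply_le hf hf' hf'c hf''c hM e he (hyh (δ k * ε))
        (hsp _ ⟨by positivity, by nlinarith [hδlt k, hε, hδpos k]⟩) i j
      have hdiff : x + ((δ k * ε : ℝ) : ℂ) • h - x = ((δ k * ε : ℝ) : ℂ) • h := by abel
      rw [hdiff] at hb
      have hDeq : Matrix.of (fun i j => ((∫ s in (0 : ℝ)..1, f' (e i + s * (e j - e i)) : ℝ) : ℂ) *
          (((δ k * ε : ℝ) : ℂ) • h) i j) = ((δ k * ε : ℝ) : ℂ) • D := by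
        ext i j; simp only [hD, Matrix.of_apply, Matrix.smul_apply, smul_eq_mul]; ring
      rw [hDeq] at hb
      exact hb
    -- `N k i j = target + error_k / δ_k`
    have hNij : ∀ k, N k i j = (cfc f (x + (ε : ℂ) • h) - cfc f x - (ε : ℂ) • D) i j -
        ((δ k)⁻¹ : ℂ) * (cfc f (x + ((δ k * ε : ℝ) : ℂ) • h) - cfc f x - ((δ k * ε : ℝ) : ℂ) • D) i j := by
      intro k
      rw [hN]; dsimp only
      simp only [Matrix.sub_apply, Matrix.smul_apply, smul_eq_mul]
      have hne : (δ k : ℂ) ≠ 0 := ofReal_ne_zero.2 (hδpos k).ne'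
      push_cast
      field_simp
      ring
    simp_rw [hNij]
    rw [← sub_zero ((cfc f (x + (ε : ℂ) • h) - cfc f x - (ε : ℂ) • D) i j)]
    refine Tendsto.sub (by rw [sub_zero]; exact tendsto_const_nhds) ?_
    refine squeeze_zero_norm (a := fun k => δ k * ((Fintype.card m : ℝ) * M *
      ((∑ j', ∑ l, ‖h j' l‖) ^ 2 * ε ^ 2))) (fun k => ?_) ?_
    swap
    · simpa using hδlim.mul_const ((Fintype.card m : ℝ) * M * ((∑ j', ∑ l, ‖h j' l‖) ^ 2 * ε ^ 2))
    have hbound : ∀ k, ‖((δ k)⁻¹ : ℂ) * (cfc f (x + ((δ k * ε : ℝ) : ℂ) • h) - cfc f x -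
        ((δ k * ε : ℝ) : ℂ) • D) i j‖ ≤ δ k * ((Fintype.card m : ℝ) * M * ((∑ j', ∑ l, ‖h j' l‖) ^ 2 * ε ^ 2)) := by
      intro k
      rw [norm_mul, norm_inv, Complex.norm_real, Real.norm_eq_abs, abs_of_pos (hδpos k)]
      have h1 := hrem k
      have hS : (∑ j', ∑ l, ‖(((δ k * ε : ℝ) : ℂ) • h) j' l‖) = (δ k * ε) * ∑ j', ∑ l, ‖h j' l‖ := by
        rw [Finset.mul_sum]
        refine Finset.sum_congr rfl fun j' _ => ?_
        rw [Finset.mul_sum]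
        refine Finset.sum_congr rfl fun l _ => ?_
        rw [Matrix.smul_apply, smul_eq_mul, norm_mul, Complex.norm_real, Real.norm_eq_abs,
          abs_of_pos (mul_pos (hδpos k) hε)]
      rw [hS] at h1
      have hδk := hδpos k
      calc (δ k)⁻¹ * ‖(cfc f (x + ((δ k * ε : ℝ) : ℂ) • h) - cfc f x - ((δ k * ε : ℝ) : ℂ) • D) i j‖
          ≤ (δ k)⁻¹ * ((Fintype.card m : ℝ) * M * ((δ k * ε) * ∑ j', ∑ l, ‖h j' l‖) ^ 2) := by
            gcongr
        _ = δ k * ((Fintype.card m : ℝ) * M * ((∑ j', ∑ l, ‖h j' l‖) ^ 2 * ε ^ 2)) := by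
            field_simp
    exact hbound k
  exact posSemidef_of_tendsto_entry hNpsd hconvN

end RemainderPSD

section HPLimit

open MeasureTheory

/-- **Hansen–Pedersen's second-order positivity** (Hansen–Pedersen 1982, Lemmas 3.7–3.8; Hansen
2013, Theorem 3.5 for the Kraus matrix `H(0)`): if `f ∈ C²[a, b]` is operator convex (at level
`n + 1`) then for `u, d₁, …, dₙ ∈ (a, b)` the matrix of second divided differences `([u, dᵢ, dⱼ]_f)`
is positive semidefinite. Proof: with `x = diag(u, d)`, `h = ∑ (eᵢ₀ + e₀ᵢ)`, convexity gives
`R_ε = f(x + εh) - f(x) - εDf(x)h ≥ 0`; by the exact remainder formula the compression of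
`ε⁻² R_ε` to the indices `≥ 1` is `∑ₗ [F_i(x + εh)]_{l i'}`, `F_i = [dᵢ, u, ·]_f`, which tends to
`[dᵢ, u, d_{i'}]_f` as `ε → 0` by continuity of the functional calculus. [cite: Hansen2013, Theorem 3.5] -/
theorem secondDividedDiff_matrix_posSemidef_of_opConvex {f f' f'' : ℝ → ℝ} {a b : ℝ}
    (hf : ∀ x ∈ Icc a b, HasDerivAt f (f' x) x) (hf' : ∀ x ∈ Icc a b, HasDerivAt f' (f'' x) x)
    (hf'c : Continuous f') (hf''c : Continuous f'') {n : ℕ}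
    (hconv : ∀ X Y : Matrix (Fin (n + 1)) (Fin (n + 1)) ℂ, X.IsHermitian → Y.IsHermitian →
      spectrum ℝ X ⊆ Icc a b → spectrum ℝ Y ⊆ Icc a b → ∀ s : ℝ, 0 ≤ s → s ≤ 1 →
        ((s : ℂ) • cfc f X + ((1 - s : ℝ) : ℂ) • cfc f Y -
          cfc f ((s : ℂ) • X + ((1 - s : ℝ) : ℂ) • Y)).PosSemidef)
    {u : ℝ} (hu : u ∈ Ioo a b) (d : Fin n → ℝ) (hd : ∀ i, d i ∈ Ioo a b) :
    (Matrix.of fun i j : Fin n => ((∫ s in (0 : ℝ)..1, ∫ ρ in (0 : ℝ)..1,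
      s * f'' (u + s * (d i - u) + s * ρ * (d j - d i)) : ℝ) : ℂ)).PosSemidef := by
  -- nodes `e = (u, d)` and the diagonal base point
  set e : Fin (n + 1) → ℝ := Fin.cases u d with he
  have he0 : e 0 = u := by simp [he]
  have hes : ∀ i : Fin n, e i.succ = d i := fun i => by simp [he]
  have heI : ∀ a', e a' ∈ Ioo a b := by
    intro a'
    refine Fin.cases ?_ (fun i => ?_) a'
    · rw [he0]; exact hu
    · rw [hes]; exact hd i
  have heJ : ∀ a', e a' ∈ Icc a b := fun a' => Ioo_subset_Icc_self (heI a')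
  set x : Matrix (Fin (n + 1)) (Fin (n + 1)) ℂ := diagonal fun a' => (e a' : ℂ) with hx
  obtain ⟨hhh, hhle, hhge⟩ := hp_direction_bounds (n := n)
  set h : Matrix (Fin (n + 1)) (Fin (n + 1)) ℂ := Matrix.of fun a' c : Fin (n + 1) =>
    (if a' = 0 then (if c = 0 then (0 : ℂ) else 1) else (if c = 0 then 1 else 0)) with hh
  have hxh : x.IsHermitian := by
    rw [hx, Matrix.IsHermitian, diagonal_conjTranspose]; congr 1; funext i; simp
  have hyh : ∀ τ : ℝ, (x + (τ : ℂ) • h).IsHermitian := fun τ => by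
    refine hxh.add ?_
    unfold Matrix.IsHermitian; rw [conjTranspose_smul, hhh.eq]; simp
  -- a margin `ρ > 0` around the nodes, and the admissible `ε₀`
  obtain ⟨ρ, hρ, hρle⟩ : ∃ ρ : ℝ, 0 < ρ ∧ ∀ a', a + ρ ≤ e a' ∧ e a' + ρ ≤ b := by
    set g : Fin (n + 1) → ℝ := fun a' => min (e a' - a) (b - e a') with hg
    set ρ : ℝ := Finset.univ.inf' ⟨0, Finset.mem_univ _⟩ g with hρdef
    have hρle' : ∀ a', ρ ≤ g a' := fun a' => Finset.inf'_le g (Finset.mem_univ a')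
    obtain ⟨a₀, -, ha₀⟩ := Finset.exists_mem_eq_inf' (⟨0, Finset.mem_univ _⟩ :
      (Finset.univ : Finset (Fin (n + 1))).Nonempty) g
    have hρpos : 0 < ρ := by
      rw [hρdef, ha₀, hg]; dsimp only
      exact lt_min (by linarith [(heI a₀).1]) (by linarith [(heI a₀).2])
    refine ⟨ρ, hρpos, fun a' => ⟨?_, ?_⟩⟩
    · have := (hρle' a').trans (min_le_left _ _); linarith
    · have := (hρle' a').trans (min_le_right _ _); linarith
  set ε₀ : ℝ := ρ / ((n + 1 : ℕ) : ℝ) with hε₀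
  have hnpos : (0 : ℝ) < ((n + 1 : ℕ) : ℝ) := by positivity
  have hε₀pos : 0 < ε₀ := by rw [hε₀]; positivity
  have hsp : ∀ τ ∈ Icc (0 : ℝ) ε₀, spectrum ℝ (x + (τ : ℂ) • h) ⊆ Icc a b := by
    intro τ hτ r hr
    have hτn : τ * ((n + 1 : ℕ) : ℝ) ≤ ρ := by
      calc τ * ((n + 1 : ℕ) : ℝ) ≤ ε₀ * ((n + 1 : ℕ) : ℝ) := by gcongr; exact hτ.2
        _ = ρ := by rw [hε₀]; field_simp
    have hlo : spectrum ℝ (x + (τ : ℂ) • h) ⊆ Ici a := by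
      apply spectrum_subset_Ici_of_posSemidef_sub
      have edec : x + (τ : ℂ) • h - (a : ℂ) • 1 =
          (x - ((a + τ * ((n + 1 : ℕ) : ℝ) : ℝ) : ℂ) • 1) +
            (τ : ℂ) • ((((n + 1 : ℕ) : ℝ) : ℂ) • 1 + h) := by
        push_cast; module
      rw [edec]
      refine PosSemidef.add ?_ ?_
      · rw [hx, smul_one_eq_diagonal, diagonal_sub]
        refine PosSemidef.diagonal fun a' => ?_
        rw [← ofReal_sub]
        exact Complex.zero_le_real.mpr (by linarith [(hρle a').1])
      · have : ((τ : ℂ) • ((((n + 1 : ℕ) : ℝ) : ℂ) • (1 : Matrix (Fin (n + 1)) (Fin (n + 1)) ℂ) + h)) =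
            τ • ((((n + 1 : ℕ) : ℝ) : ℂ) • (1 : Matrix (Fin (n + 1)) (Fin (n + 1)) ℂ) + h) := rfl
        rw [this]; exact hhge.smul hτ.1
    have hhi : spectrum ℝ (x + (τ : ℂ) • h) ⊆ Iic b := by
      apply spectrum_subset_Iic_of_posSemidef_sub'
      have edec : (b : ℂ) • 1 - (x + (τ : ℂ) • h) =
          (((b - τ * ((n + 1 : ℕ) : ℝ) : ℝ) : ℂ) • 1 - x) +
            (τ : ℂ) • ((((n + 1 : ℕ) : ℝ) : ℂ) • 1 - h) := by
        push_cast; module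
      rw [edec]
      refine PosSemidef.add ?_ ?_
      · rw [hx, smul_one_eq_diagonal, diagonal_sub]
        refine PosSemidef.diagonal fun a' => ?_
        rw [← ofReal_sub]
        exact Complex.zero_le_real.mpr (by linarith [(hρle a').2])
      · have : ((τ : ℂ) • ((((n + 1 : ℕ) : ℝ) : ℂ) • (1 : Matrix (Fin (n + 1)) (Fin (n + 1)) ℂ) - h)) =
            τ • ((((n + 1 : ℕ) : ℝ) : ℂ) • (1 : Matrix (Fin (n + 1)) (Fin (n + 1)) ℂ) - h) := rfl
        rw [this]; exact hhle.smul hτ.1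
    exact ⟨hlo hr, hhi hr⟩
  have hxs : spectrum ℝ x ⊆ Icc a b := by simpa using hsp 0 ⟨le_rfl, hε₀pos.le⟩
  -- the first-order derivative matrix `D = Df(x)(h)` and the remainder `R ε`
  set D : Matrix (Fin (n + 1)) (Fin (n + 1)) ℂ := Matrix.of (fun i j =>
    ((∫ s in (0 : ℝ)..1, f' (e i + s * (e j - e i)) : ℝ) : ℂ) * h i j) with hD
  set R : ℝ → Matrix (Fin (n + 1)) (Fin (n + 1)) ℂ := fun ε =>
    cfc f (x + (ε : ℂ) • h) - cfc f x - (ε : ℂ) • D with hR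
  -- STEP A/B: `R ε ≥ 0` for `0 < ε ≤ ε₀`, hence so is its compression to the indices `≥ 1`
  have hRpsd : ∀ ε : ℝ, 0 < ε → ε ≤ ε₀ → (R ε).PosSemidef := by
    intro ε hε hεle
    have := posSemidef_cfc_add_sub_cfc_sub_deriv hf hf' hf'c hf''c hconv e heJ hhh hε
      (fun τ hτ => hsp τ ⟨hτ.1, hτ.2.trans hεle⟩)
    exact this
  -- the functions `F i = [dᵢ, u, ·]_f`
  set F : Fin n → ℝ → ℝ := fun i w =>
    ∫ s in (0 : ℝ)..1, ∫ ρ' in (0 : ℝ)..1, s * f'' (d i + s * (u - d i) + s * ρ' * (w - u)) with hF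
  have hFc : ∀ i, Continuous (F i) := fun i => continuous_integral2_deriv2 hf''c (d i) u
  -- STEP C: the compressed entries of `R ε`
  have hentry : ∀ ε : ℝ, 0 < ε → ε ≤ ε₀ → ∀ i i' : Fin n,
      R ε i.succ i'.succ = (ε : ℂ) ^ 2 * ∑ l : Fin n, (cfc (F i) (x + (ε : ℂ) • h)) l.succ i'.succ := by
    intro ε hε hεle i i'
    set y : Matrix (Fin (n + 1)) (Fin (n + 1)) ℂ := x + (ε : ℂ) • h with hy
    have hyh' : y.IsHermitian := hyh ε
    set V : Matrix (Fin (n + 1)) (Fin (n + 1)) ℂ :=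
      ((hyh'.eigenvectorUnitary : Matrix.unitaryGroup (Fin (n + 1)) ℂ) :
        Matrix (Fin (n + 1)) (Fin (n + 1)) ℂ) with hV
    have hVu : V ∈ Matrix.unitaryGroup (Fin (n + 1)) ℂ := hyh'.eigenvectorUnitary.2
    set μ : Fin (n + 1) → ℝ := hyh'.eigenvalues with hμ
    have hydec : y = V * diagonal (fun i => (μ i : ℂ)) * star V := by
      have := hyh'.spectral_theorem
      rw [Unitary.conjStarAlgAut_apply] at this
      exact this
    have hμJ : ∀ k, μ k ∈ Icc a b := fun k =>
      hsp ε ⟨hε.le, hεle⟩ (hyh'.eigenvalues_mem_spectrum_real k)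
    have hyx : y - x = (ε : ℂ) • h := by rw [hy]; abel
    -- `R ε` in the form of the exact remainder lemma
    have hRform : R ε = cfc f y - cfc f x - Matrix.of (fun i j =>
        ((∫ s in (0 : ℝ)..1, f' (e i + s * (e j - e i)) : ℝ) : ℂ) * (y - x) i j) := by
      rw [hR]; dsimp only
      congr 1
      ext i j
      simp only [hyx, hD, Matrix.smul_apply, Matrix.of_apply, smul_eq_mul]
      ring
    -- `((R ε) V)_{succ i, k}`
    have hRV : ∀ k, (R ε * V) i.succ k = (ε : ℂ) ^ 2 * ((F i (μ k) : ℝ) : ℂ) * ∑ l : Fin n, V l.succ k := by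
      intro k
      have hmain := cfc_sub_cfc_sub_deriv_mul_apply hf hf' hf'c hf''c e heJ hVu μ hμJ i.succ k
      rw [← hydec, ← hRform] at hmain
      rw [hmain]
      -- only the term `c = 0` survives
      rw [Fin.sum_univ_succ]
      have hzero : ∀ l : Fin n, (y - x) i.succ l.succ = 0 := by
        intro l
        rw [hyx, Matrix.smul_apply, hh, Matrix.of_apply]
        simp [Fin.succ_ne_zero]
      have hrest : ∑ l : Fin n, ((∫ s in (0 : ℝ)..1, ∫ ρ' in (0 : ℝ)..1,
          s * f'' (e i.succ + s * (e l.succ - e i.succ) + s * ρ' * (μ k - e l.succ)) : ℝ) : ℂ) *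
            (y - x) i.succ l.succ * ((y - x) * V) l.succ k = 0 := by
        refine Finset.sum_eq_zero fun l _ => ?_
        rw [hzero l, mul_zero, zero_mul]
      rw [hrest, add_zero]
      have h0 : (y - x) i.succ 0 = (ε : ℂ) := by
        rw [hyx, Matrix.smul_apply, hh, Matrix.of_apply]
        simp [Fin.succ_ne_zero]
      have h0V : ((y - x) * V) 0 k = (ε : ℂ) * ∑ l : Fin n, V l.succ k := by
        rw [Matrix.mul_apply, Fin.sum_univ_succ, hyx]
        simp only [Matrix.smul_apply, hh, Matrix.of_apply, if_true, smul_eq_mul, mul_zero, zero_mul,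
          zero_add, Fin.succ_ne_zero, if_false, mul_one, Finset.mul_sum]
      rw [h0, h0V, hes i, he0, hF]
      ring
    -- back to `R ε = (R ε V) V⋆`
    have hVV : V * star V = 1 := Matrix.mem_unitaryGroup_iff.mp hVu
    have hRRV : R ε = R ε * V * star V := by rw [Matrix.mul_assoc, hVV, Matrix.mul_one]
    have hcfcF : cfc (F i) y = V * diagonal (fun k => ((F i (μ k) : ℝ) : ℂ)) * star V := by
      have hDm : (diagonal fun k => (μ k : ℂ)).IsHermitian := by
        rw [Matrix.IsHermitian, diagonal_conjTranspose]; congr 1; funext i; simp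
      rw [hydec, cfc_unitary_conj hDm hVu, cfc_diagonal_ofReal]
    rw [hRRV, Matrix.mul_apply]
    simp_rw [hRV]
    rw [hcfcF]
    have hVDV : ∀ p q, (V * diagonal (fun k => ((F i (μ k) : ℝ) : ℂ)) * star V) p q =
        ∑ k, V p k * ((F i (μ k) : ℝ) : ℂ) * (star V) k q := by
      intro p q; rw [Matrix.mul_apply]; simp_rw [Matrix.mul_diagonal]
    simp_rw [hVDV]
    simp only [Finset.mul_sum, Finset.sum_mul]
    conv_lhs => rw [Finset.sum_comm]
    refine Finset.sum_congr rfl fun p _ => Finset.sum_congr rfl fun q _ => ?_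
    ring
  -- STEP D: the sequence `εₖ = ε₀ / (k + 2) → 0` and the limit of the compressed matrices
  set εs : ℕ → ℝ := fun k => ε₀ / ((k : ℝ) + 2) with hεs
  have hεs_pos : ∀ k, 0 < εs k := fun k => by rw [hεs]; positivity
  have hεs_le : ∀ k, εs k ≤ ε₀ := fun k => by
    rw [hεs]; dsimp only
    rw [div_le_iff₀ (by positivity)]
    nlinarith [hε₀pos, (Nat.cast_nonneg k : (0 : ℝ) ≤ k)]
  have hεs_lim : Tendsto εs atTop (𝓝 0) := by
    have h1 : Tendsto (fun k : ℕ => (k : ℝ) + 2) atTop atTop :=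
      tendsto_atTop_add_const_right _ _ tendsto_natCast_atTop_atTop
    have h2 := h1.inv_tendsto_atTop
    have h3 : Tendsto (fun k : ℕ => ε₀ * ((k : ℝ) + 2)⁻¹) atTop (𝓝 (ε₀ * 0)) := h2.const_mul ε₀
    rw [mul_zero] at h3
    refine h3.congr' (Eventually.of_forall fun k => ?_)
    rw [hεs]; dsimp only; rw [div_eq_mul_inv]
  obtain ⟨M, hM⟩ : ∃ M : ℕ → Matrix (Fin n) (Fin n) ℂ, ∀ k i i',
      M k i i' = ∑ l : Fin n, (cfc (F i) (x + ((εs k : ℝ) : ℂ) • h)) l.succ i'.succ :=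
    ⟨fun k => Matrix.of fun i i' : Fin n =>
      ∑ l : Fin n, (cfc (F i) (x + ((εs k : ℝ) : ℂ) • h)) l.succ i'.succ, fun k i i' => rfl⟩
  have hMpsd : ∀ k, (M k).PosSemidef := by
    intro k
    have hsub : ((R (εs k)).submatrix Fin.succ Fin.succ).PosSemidef :=
      (hRpsd (εs k) (hεs_pos k) (hεs_le k)).submatrix Fin.succ
    have hMeq : M k = ((εs k) ^ 2)⁻¹ • (R (εs k)).submatrix Fin.succ Fin.succ := by
      ext i i'
      rw [hM, Matrix.smul_apply, submatrix_apply, hentry (εs k) (hεs_pos k) (hεs_le k) i i',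
        Complex.real_smul]
      push_cast
      have hne : ((εs k : ℝ) : ℂ) ≠ 0 := ofReal_ne_zero.mpr (hεs_pos k).ne'
      field_simp
    rw [hMeq]
    exact hsub.smul (by positivity)
  -- continuity of the functional calculus along `x + εₖ h → x`
  have hylim : Tendsto (fun k => x + ((εs k : ℝ) : ℂ) • h) atTop (𝓝 x) := by
    have h1 : Tendsto (fun k => ((εs k : ℝ) : ℂ)) atTop (𝓝 ((0 : ℝ) : ℂ)) :=
      (continuous_ofReal.tendsto 0).comp hεs_lim
    have h2 : Tendsto (fun k => ((εs k : ℝ) : ℂ) • h) atTop (𝓝 (((0 : ℝ) : ℂ) • h)) :=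
      h1.smul_const h
    have h3 := h2.const_add x
    simpa using h3
  have hcfclim : ∀ i, Tendsto (fun k => cfc (F i) (x + ((εs k : ℝ) : ℂ) • h)) atTop
      (𝓝 (cfc (F i) x)) := by
    intro i
    exact Filter.Tendsto.cfc (isCompact_Icc) (F i) hylim
      (Eventually.of_forall fun k => hsp (εs k) ⟨(hεs_pos k).le, hεs_le k⟩)
      (Eventually.of_forall fun k => (hyh (εs k) : IsSelfAdjoint (x + ((εs k : ℝ) : ℂ) • h)))
      hxs (hxh : IsSelfAdjoint x) (hFc i).continuousOn
  have hcfcx : ∀ i, cfc (F i) x = diagonal fun a' => ((F i (e a') : ℝ) : ℂ) := fun i => by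
    rw [hx, cfc_diagonal_ofReal]
  -- the limit matrix
  have hlimit : ∀ i i', Tendsto (fun k => M k i i') atTop (𝓝 (((F i (d i') : ℝ) : ℂ))) := by
    intro i i'
    have hent : ∀ l : Fin n, Tendsto (fun k => (cfc (F i) (x + ((εs k : ℝ) : ℂ) • h)) l.succ i'.succ)
        atTop (𝓝 ((cfc (F i) x) l.succ i'.succ)) := fun l =>
      ((continuous_apply i'.succ).tendsto _).comp
        (((continuous_apply l.succ).tendsto _).comp (hcfclim i))
    have hsum := tendsto_finsetSum (Finset.univ : Finset (Fin n)) fun l _ => hent l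
    have hval : ∑ l : Fin n, (cfc (F i) x) l.succ i'.succ = ((F i (d i') : ℝ) : ℂ) := by
      rw [hcfcx i]
      simp_rw [diagonal_apply]
      simp only [Fin.succ_inj, Finset.sum_ite_eq', Finset.mem_univ, if_true, hes]
    rw [← hval]
    refine hsum.congr fun k => ?_
    rw [hM]
  have hPSD : (Matrix.of fun i i' : Fin n => ((F i (d i') : ℝ) : ℂ)).PosSemidef :=
    posSemidef_of_tendsto_entry hMpsd fun i i' => by simpa using hlimit i i'
  -- finally `[dᵢ, u, dⱼ]_f = [u, dᵢ, dⱼ]_f`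
  convert hPSD using 1
  ext i j
  rw [Matrix.of_apply, Matrix.of_apply, hF]
  dsimp only
  rw [integral2_deriv2_swap hf hf' hf'c hf''c hu (hd i) (hd j)]

end HPLimit

section BendatShermanInterior

open MeasureTheory

/-- **Interior Bendat–Sherman theorem, smooth case** (Hansen–Pedersen 1982, Theorem 3.9 /
Hansen 2013, Corollary 3.6, for `C²` functions): if `f ∈ C²[a, b]` is operator convex at level
`n + 1` on `[a, b]` and `u ∈ (a, b)`, then the divided difference
`g(t) = [u, t]_f = ∫₀¹ f'(u + s (t - u)) ds` (`= (f t - f u)/(t - u)` for `t ≠ u`) is matrix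
monotone of order `n` on `(a, b)`. Proof: its Loewner matrices are the second divided-difference
matrices `([u, dᵢ, dⱼ]_f)`, positive by `secondDividedDiff_matrix_posSemidef_of_opConvex`, and
Hansen's Theorem 3.2 (⇐) applies. [cite: Hansen2013, Corollary 3.6; HansenPedersen1982, Theorem 3.9] -/
theorem dividedDiff_matrixMonotone_of_opConvex {f f' f'' : ℝ → ℝ} {a b : ℝ}
    (hf : ∀ x ∈ Icc a b, HasDerivAt f (f' x) x) (hf' : ∀ x ∈ Icc a b, HasDerivAt f' (f'' x) x)
    (hf'c : Continuous f') (hf''c : Continuous f'') {n : ℕ}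
    (hconv : ∀ X Y : Matrix (Fin (n + 1)) (Fin (n + 1)) ℂ, X.IsHermitian → Y.IsHermitian →
      spectrum ℝ X ⊆ Icc a b → spectrum ℝ Y ⊆ Icc a b → ∀ s : ℝ, 0 ≤ s → s ≤ 1 →
        ((s : ℂ) • cfc f X + ((1 - s : ℝ) : ℂ) • cfc f Y -
          cfc f ((s : ℂ) • X + ((1 - s : ℝ) : ℂ) • Y)).PosSemidef)
    {u : ℝ} (hu : u ∈ Ioo a b) (A B : Matrix (Fin n) (Fin n) ℂ) (hA : A.IsHermitian)
    (hB : B.IsHermitian) (hAs : spectrum ℝ A ⊆ Ioo a b) (hBs : spectrum ℝ B ⊆ Ioo a b)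
    (hAB : (B - A).PosSemidef) :
    (cfc (fun t : ℝ => ∫ s in (0 : ℝ)..1, f' (u + s * (t - u))) B -
      cfc (fun t : ℝ => ∫ s in (0 : ℝ)..1, f' (u + s * (t - u))) A).PosSemidef := by
  have hu' : u ∈ Icc a b := Ioo_subset_Icc_self hu
  refine matrixMonotone_of_loewner_matrix_posSemidef
    (f := fun t : ℝ => ∫ s in (0 : ℝ)..1, f' (u + s * (t - u)))
    (f' := fun t : ℝ => ∫ s in (0 : ℝ)..1, ∫ ρ in (0 : ℝ)..1,
      s * f'' (u + s * (t - u) + s * ρ * (t - t)))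
    (fun t ht => hasDerivAt_integral_deriv_segment hf' hf''c hu ht) ?_ ?_ A B hA hB hAs hBs hAB
  · have hc := (continuous_integral2_deriv2_pair hf''c u).comp
      (continuous_id.prodMk continuous_id : Continuous fun t : ℝ => (t, t))
    exact hc.continuousOn
  · intro d hd
    have hP := secondDividedDiff_matrix_posSemidef_of_opConvex hf hf' hf'c hf''c hconv hu d hd
    convert hP using 2
    ext i j
    refine congrArg (fun r : ℝ => (r : ℂ)) ?_
    split_ifs with hij
    · rw [hij]
    · have hmul := integral2_deriv2_mul_sub hf' hf''c hu' (Ioo_subset_Icc_self (hd i))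
        (Ioo_subset_Icc_self (hd j))
      rw [slope_def_field, div_eq_iff (sub_ne_zero.2 hij)]
      linear_combination hmul

end BendatShermanInterior

section Regularisation

open MeasureTheory

/-- **Regularisation** (Hansen 2013, §2.1): an operator monotone function on `(0, ∞)` is the
pointwise limit of a sequence of `C^∞` operator monotone functions on `(0, ∞)`; here
`F_k(x) = ∫ φ_k(t) f(x + 2ε_k - t) dt` with a bump `φ_k` supported in `(-ε_k, ε_k)`, `ε_k = 1/(k+1)`.
[cite: Hansen2013, §2.1] -/
theorem exists_smooth_matrixMonotone_approx {f : ℝ → ℝ} (hf : IsMatrixMonotoneOn f (Ioi 0)) :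
    ∃ F : ℕ → ℝ → ℝ, (∀ k, ContDiff ℝ ((⊤ : ℕ∞) : WithTop ℕ∞) (F k)) ∧
      (∀ k, IsMatrixMonotoneOn (F k) (Ioi 0)) ∧
        ∀ x, 0 < x → Tendsto (fun k => F k x) atTop (𝓝 (f x)) := by
  have hcont := continuousOn_of_isMatrixMonotoneOn_Ioi hf
  set ε : ℕ → ℝ := fun k => 1 / ((k : ℝ) + 1) with hε
  have hεpos : ∀ k, 0 < ε k := fun k => by rw [hε]; positivity
  have hεlim : Tendsto ε atTop (𝓝 0) := tendsto_one_div_add_atTop_nhds_zero_nat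
  set φ : ∀ k : ℕ, ContDiffBump (0 : ℝ) := fun k =>
    ⟨ε k / 2, ε k, half_pos (hεpos k), half_lt_self (hεpos k)⟩ with hφ
  set g : ℕ → ℝ → ℝ := fun k y => f (max y (ε k)) with hg
  have hgc : ∀ k, Continuous (g k) := fun k =>
    hcont.comp_continuous (continuous_id.max continuous_const) fun y =>
      lt_of_lt_of_le (hεpos k) (le_max_right _ _)
  set F : ℕ → ℝ → ℝ := fun k x =>
    MeasureTheory.convolution ((φ k).normed volume) (g k) (ContinuousLinearMap.lsmul ℝ ℝ) volume
      (x + 2 * ε k) with hF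
  have hFx : ∀ k x, F k x = ∫ t, (φ k).normed volume t * g k (x + 2 * ε k - t) := by
    intro k x
    rw [hF]; dsimp only
    rw [convolution_lsmul]
    rfl
  refine ⟨F, fun k => ?_, fun k => ?_, fun x hx => ?_⟩
  · -- smoothness
    have h1 : ContDiff ℝ ((⊤ : ℕ∞) : WithTop ℕ∞)
        (MeasureTheory.convolution ((φ k).normed volume) (g k) (ContinuousLinearMap.lsmul ℝ ℝ)
          volume) :=
      (φ k).hasCompactSupport_normed.contDiff_convolution_left _ (φ k).contDiff_normed
        ((hgc k).locallyIntegrable)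
    exact h1.comp (contDiff_id.add contDiff_const)
  · -- matrix monotonicity on `(0, ∞)`
    intro n A B hA hB hAs hBs hAB
    rw [← Matrix.le_iff, cfc_le_cfc_iff hA hB]
    intro v
    set U : Matrix (Fin n) (Fin n) ℂ := (hA.eigenvectorUnitary : Matrix (Fin n) (Fin n) ℂ) with hU
    set W : Matrix (Fin n) (Fin n) ℂ := (hB.eigenvectorUnitary : Matrix (Fin n) (Fin n) ℂ) with hW
    -- integrability of the relevant integrands
    have hint : ∀ (μ c : ℝ), Integrable (fun t => (φ k).normed volume t * (g k (μ + 2 * ε k - t) * c)) := by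
      intro μ c
      refine Continuous.integrable_of_hasCompactSupport ?_ ?_
      · exact (φ k).continuous_normed.mul
          (((hgc k).comp (continuous_const.sub continuous_id)).mul continuous_const)
      · exact (φ k).hasCompactSupport_normed.mul_right
    have hrepr : ∀ (lam : Fin n → ℝ) (c : Fin n → ℝ),
        ∑ i, F k (lam i) * c i =
          ∫ t, (φ k).normed volume t * ∑ i, g k (lam i + 2 * ε k - t) * c i := by
      intro lam c
      have hfun : (fun t => (φ k).normed volume t * ∑ i, g k (lam i + 2 * ε k - t) * c i) =
          fun t => ∑ i, (φ k).normed volume t * (g k (lam i + 2 * ε k - t) * c i) := by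
        funext t; rw [Finset.mul_sum]
      rw [hfun, integral_finsetSum _ fun i _ => hint (lam i) (c i)]
      refine Finset.sum_congr rfl fun i _ => ?_
      rw [hFx, ← integral_mul_const]
      congr 1
      funext t
      ring
    rw [hrepr, hrepr]
    refine integral_mono ?_ ?_ fun t => ?_
    · simp_rw [Finset.mul_sum]
      exact integrable_finsetSum _ fun i _ => hint _ _
    · simp_rw [Finset.mul_sum]
      exact integrable_finsetSum _ fun i _ => hint _ _
    · -- pointwise comparison of the integrands
      by_cases ht : (φ k).normed volume t = 0
      · simp only [ht, zero_mul, le_refl]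
      · have htε : |t| < ε k := by
          have hmem : t ∈ Function.support ((φ k).normed volume) := ht
          rw [(φ k).support_normed_eq] at hmem
          simpa [Real.ball_eq_Ioo, abs_lt, hφ] using hmem
        refine mul_le_mul_of_nonneg_left ?_ ((φ k).nonneg_normed t)
        -- the shifted function `y ↦ f (y + (2ε - t))` is matrix monotone on `(0, ∞)`
        set c : ℝ := 2 * ε k - t with hc
        have hcpos : 0 < c := by rw [hc]; linarith [(abs_lt.mp htε).2, hεpos k]
        have hApd : A.PosDef := posDef_of_spectrum_subset_Ioi hA hAs
        have hBpd : B.PosDef := posDef_of_spectrum_subset_Ioi hB hBs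
        have h1psd : ((c : ℂ) • (1 : Matrix (Fin n) (Fin n) ℂ)).PosSemidef := by
          have : ((c : ℂ) • (1 : Matrix (Fin n) (Fin n) ℂ)) = c • (1 : Matrix (Fin n) (Fin n) ℂ) := rfl
          rw [this]; exact PosSemidef.one.smul hcpos.le
        have hAc : (A + (c : ℂ) • 1).PosDef := hApd.add_posSemidef h1psd
        have hBc : (B + (c : ℂ) • 1).PosDef := hBpd.add_posSemidef h1psd
        have hmono := hf n (A + (c : ℂ) • 1) (B + (c : ℂ) • 1) hAc.1 hBc.1
          (fun x hx => spectrum_subset_Ioi_of_posDef hAc hx)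
          (fun x hx => spectrum_subset_Ioi_of_posDef hBc hx) (by simpa using hAB)
        rw [cfc_add_smul_one hA, cfc_add_smul_one hB, ← Matrix.le_iff] at hmono
        have hcongrA : cfc (fun y => f (y + c)) A = cfc (fun y => g k (y + 2 * ε k - t)) A := by
          refine cfc_congr fun y hy => ?_
          have hy0 : 0 < y := hAs hy
          simp only [hg, hc]
          rw [max_eq_left (by linarith [(abs_lt.mp htε).2])]
          ring_nf
        have hcongrB : cfc (fun y => f (y + c)) B = cfc (fun y => g k (y + 2 * ε k - t)) B := by
          refine cfc_congr fun y hy => ?_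
          have hy0 : 0 < y := hBs hy
          simp only [hg, hc]
          rw [max_eq_left (by linarith [(abs_lt.mp htε).2])]
          ring_nf
        rw [hcongrA, hcongrB, cfc_le_cfc_iff hA hB] at hmono
        exact hmono v
  · -- pointwise convergence
    have h := ContDiffBump.convolution_tendsto_right (μ := volume) (φ := φ) (g := g)
      (k := fun i => x + 2 * ε i) (x₀ := x) (z₀ := f x) (l := atTop) ?_
      (Eventually.of_forall fun i => (hgc i).aestronglyMeasurable) ?_ ?_
    · simpa [hFx, convolution_lsmul] using h
    · show Tendsto (fun i => ε i) atTop (𝓝 0)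
      exact hεlim
    · -- joint continuity: `f (max y εᵢ) → f x`
      have hmax : Tendsto (fun p : ℕ × ℝ => max p.2 (ε p.1)) (atTop ×ˢ 𝓝 x) (𝓝[Ioi 0] x) := by
        refine tendsto_nhdsWithin_iff.mpr ⟨?_, Eventually.of_forall fun p => ?_⟩
        · have h1 : Tendsto (fun p : ℕ × ℝ => p.2) (atTop ×ˢ 𝓝 x) (𝓝 x) := tendsto_snd
          have h2 : Tendsto (fun p : ℕ × ℝ => ε p.1) (atTop ×ˢ 𝓝 x) (𝓝 0) :=
            hεlim.comp tendsto_fst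
          simpa [max_eq_left hx.le] using h1.max h2
        · exact lt_of_lt_of_le (hεpos p.1) (le_max_right _ _)
      exact (hcont x hx).tendsto.comp hmax
    · have : Tendsto (fun i => x + 2 * ε i) atTop (𝓝 (x + 2 * 0)) :=
        tendsto_const_nhds.add (hεlim.const_mul 2)
      simpa using this

end Regularisation

section BendatShermanGeneral

open MeasureTheory

variable {n : ℕ}

/-- Pointwise limits preserve Löwner-order comparisons of the functional calculus:
if `F_k(A) ≤ F_k(B)` for all `k` and `F_k → g` pointwise on the spectra then `g(A) ≤ g(B)`.
[folklore] -/
theorem posSemidef_cfc_sub_cfc_of_tendsto {A B : Matrix (Fin n) (Fin n) ℂ} (hA : A.IsHermitian)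
    (hB : B.IsHermitian) {F : ℕ → ℝ → ℝ} {g : ℝ → ℝ}
    (hlimA : ∀ x ∈ spectrum ℝ A, Tendsto (fun k => F k x) atTop (𝓝 (g x)))
    (hlimB : ∀ x ∈ spectrum ℝ B, Tendsto (fun k => F k x) atTop (𝓝 (g x)))
    (hle : ∀ k, (cfc (F k) B - cfc (F k) A).PosSemidef) : (cfc g B - cfc g A).PosSemidef := by
  rw [← Matrix.le_iff, cfc_le_cfc_iff hA hB]
  intro v
  have hk : ∀ k, ∑ i, F k (hA.eigenvalues i) *
      Complex.normSq ((star (hA.eigenvectorUnitary : Matrix (Fin n) (Fin n) ℂ) *ᵥ v) i) ≤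
      ∑ i, F k (hB.eigenvalues i) *
        Complex.normSq ((star (hB.eigenvectorUnitary : Matrix (Fin n) (Fin n) ℂ) *ᵥ v) i) := by
    intro k
    have h := hle k
    rw [← Matrix.le_iff, cfc_le_cfc_iff hA hB] at h
    exact h v
  refine le_of_tendsto_of_tendsto' (b := atTop) ?_ ?_ hk
  · exact tendsto_finsetSum _ fun i _ =>
      (hlimA _ (hA.eigenvalues_mem_spectrum_real i)).mul_const _
  · exact tendsto_finsetSum _ fun i _ =>
      (hlimB _ (hB.eigenvalues_mem_spectrum_real i)).mul_const _

/-- **Bendat–Sherman theorem, general form** (Hansen 2013, Theorem 3.7 / Corollary 3.8): an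
operator monotone function `f` on `(0, ∞)` is differentiable at every `t₀ > 0`, and the divided
difference `t ↦ [t₀, t]_f` (with the value `f'(t₀)` at `t₀`) is operator monotone *decreasing*
on `(0, ∞)`. Proof: regularise, apply the smooth interior Bendat–Sherman theorem to the operator
convex functions `-f_ε` (operator concavity from Hansen's Corollary 2.2), extract a convergent
subsequence of `f_ε'(t₀)` and pass to the limit; continuity of the limit (Theorem 2.1) gives the
differentiability. [cite: Hansen2013, Theorem 3.7] -/
theorem exists_hasDerivAt_dividedDiff_antitone {f : ℝ → ℝ} (hf : IsMatrixMonotoneOn f (Ioi 0))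
    {t₀ : ℝ} (ht₀ : 0 < t₀) :
    ∃ c : ℝ, HasDerivAt f c t₀ ∧
      IsMatrixMonotoneOn (fun t => -(if t = t₀ then c else slope f t₀ t)) (Ioi 0) := by
  obtain ⟨F, hFs, hFm, hFlim⟩ := exists_smooth_matrixMonotone_approx hf
  -- derivatives of the approximants
  have hF1 : ∀ k x, HasDerivAt (F k) (deriv (F k) x) x := fun k x =>
    (((hFs k).differentiable (by simp)).differentiableAt).hasDerivAt
  have hFs' : ∀ k, ContDiff ℝ ((⊤ : ℕ∞) : WithTop ℕ∞) (deriv (F k)) := fun k => by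
    have := (hFs k).iterate_deriv 1
    simpa using this
  have hF2 : ∀ k x, HasDerivAt (deriv (F k)) (deriv (deriv (F k)) x) x := fun k x =>
    (((hFs' k).differentiable (by simp)).differentiableAt).hasDerivAt
  have hFs'' : ∀ k, ContDiff ℝ ((⊤ : ℕ∞) : WithTop ℕ∞) (deriv (deriv (F k))) := fun k => by
    have := (hFs' k).iterate_deriv 1
    simpa using this
  have hconc : ∀ k, ConcaveOn ℝ (Ioi 0) (F k) := fun k => concaveOn_of_isMatrixMonotoneOn_Ioi (hFm k)
  -- the derivatives at `t₀` form a bounded sequence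
  set d : ℕ → ℝ := fun k => deriv (F k) t₀ with hd
  have hlow : ∀ k, slope (F k) t₀ (2 * t₀) ≤ d k := fun k =>
    (hconc k).slope_le_of_hasDerivAt ht₀ (by show 0 < 2 * t₀; linarith) (by linarith) (hF1 k t₀)
  have hupp : ∀ k, d k ≤ slope (F k) (t₀ / 2) t₀ := fun k =>
    (hconc k).le_slope_of_hasDerivAt (by show 0 < t₀ / 2; linarith) ht₀ (by linarith) (hF1 k t₀)
  have hsl1 : Tendsto (fun k => slope (F k) t₀ (2 * t₀)) atTop (𝓝 (slope f t₀ (2 * t₀))) := by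
    simp only [slope_def_field]
    exact ((hFlim _ (by linarith)).sub (hFlim _ ht₀)).div_const _
  have hsl2 : Tendsto (fun k => slope (F k) (t₀ / 2) t₀) atTop (𝓝 (slope f (t₀ / 2) t₀)) := by
    simp only [slope_def_field]
    exact ((hFlim _ ht₀).sub (hFlim _ (by linarith))).div_const _
  obtain ⟨m, hm⟩ := hsl1.bddBelow_range
  obtain ⟨M, hM⟩ := hsl2.bddAbove_range
  have hbdd : Bornology.IsBounded (Icc m M) := Metric.isBounded_Icc m M
  have hdmem : ∀ k, d k ∈ Icc m M := fun k =>
    ⟨(hm (mem_range_self k)).trans (hlow k), (hupp k).trans (hM (mem_range_self k))⟩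
  obtain ⟨c, -, ψ, hψ, hc⟩ := tendsto_subseq_of_bounded hbdd hdmem
  -- the candidate divided difference
  set G : ℝ → ℝ := fun t => if t = t₀ then c else slope f t₀ t with hG
  have hGm : IsMatrixMonotoneOn (fun t => -G t) (Ioi 0) := by
    intro n A B hA hB hAs hBs hAB
    -- a compact interval `[a, b] ⊂ (0, ∞)` containing the spectra and `t₀` in its interior
    have hSf : (spectrum ℝ A ∪ spectrum ℝ B).Finite :=
      (Matrix.finite_real_spectrum (A := A)).union (Matrix.finite_real_spectrum (A := B))
    set T : Finset ℝ := insert t₀ hSf.toFinset with hT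
    have hTne : T.Nonempty := ⟨t₀, Finset.mem_insert_self _ _⟩
    have hTpos : ∀ x ∈ T, 0 < x := by
      intro x hx
      rw [hT, Finset.mem_insert, Set.Finite.mem_toFinset] at hx
      rcases hx with rfl | hx
      · exact ht₀
      · rcases hx with hx | hx
        · exact hAs hx
        · exact hBs hx
    set a : ℝ := T.min' hTne / 2 with ha
    set b : ℝ := T.max' hTne + 1 with hb
    have hapos : 0 < a := by rw [ha]; exact half_pos (hTpos _ (T.min'_mem hTne))
    have hmemT : ∀ x ∈ T, x ∈ Ioo a b := fun x hx =>
      ⟨by have h1 := T.min'_le x hx; have h2 := hTpos _ (T.min'_mem hTne); rw [ha]; linarith,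
        by have := T.le_max' x hx; rw [hb]; linarith⟩
    have ht₀ab : t₀ ∈ Ioo a b := hmemT t₀ (Finset.mem_insert_self _ _)
    have hAab : spectrum ℝ A ⊆ Ioo a b := fun x hx =>
      hmemT x (by rw [hT, Finset.mem_insert, Set.Finite.mem_toFinset]; exact Or.inr (Or.inl hx))
    have hBab : spectrum ℝ B ⊆ Ioo a b := fun x hx =>
      hmemT x (by rw [hT, Finset.mem_insert, Set.Finite.mem_toFinset]; exact Or.inr (Or.inr hx))
    -- the smooth case, for `-F (ψ k)` on `[a, b]`
    have hstep : ∀ k, (cfc (fun t => ∫ s in (0 : ℝ)..1, -deriv (F (ψ k)) (t₀ + s * (t - t₀))) B -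
        cfc (fun t => ∫ s in (0 : ℝ)..1, -deriv (F (ψ k)) (t₀ + s * (t - t₀))) A).PosSemidef := by
      intro k
      refine dividedDiff_matrixMonotone_of_opConvex (f := fun t => -F (ψ k) t)
        (f' := fun t => -deriv (F (ψ k)) t) (f'' := fun t => -deriv (deriv (F (ψ k))) t)
        (a := a) (b := b) (fun x _ => (hF1 _ x).neg) (fun x _ => (hF2 _ x).neg)
        ((hFs' _).continuous.neg) ((hFs'' _).continuous.neg) (n := n) ?_ ht₀ab A B hA hB hAab hBab hAB
      intro X Y hX hY hXs hYs s hs0 hs1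
      have hXpd : X.PosDef := posDef_of_spectrum_subset_Ioi hX fun x hx => hapos.trans_le (hXs hx).1
      have hYpd : Y.PosDef := posDef_of_spectrum_subset_Ioi hY fun x hx => hapos.trans_le (hYs hx).1
      have h := smul_cfc_add_smul_cfc_le_cfc (hFm (ψ k)) hXpd hYpd hs0 hs1
      rw [cfc_neg, cfc_neg, cfc_neg]
      convert h using 1
      simp only [smul_neg]
      abel
    -- pass to the limit `k → ∞`
    have hlimpt : ∀ x ∈ Ioo a b, Tendsto
        (fun k => ∫ s in (0 : ℝ)..1, -deriv (F (ψ k)) (t₀ + s * (x - t₀))) atTop (𝓝 (-G x)) := by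
      intro x hx
      have heq : ∀ k, (∫ s in (0 : ℝ)..1, -deriv (F (ψ k)) (t₀ + s * (x - t₀))) =
          if t₀ = x then -deriv (F (ψ k)) t₀ else slope (fun t => -F (ψ k) t) t₀ x := fun k =>
        integral_deriv_segment_eq_ite (f := fun t => -F (ψ k) t) (f' := fun t => -deriv (F (ψ k)) t)
          (a := a) (b := b) (fun x _ => (hF1 _ x).neg) ((hFs' _).continuous.neg)
          (Ioo_subset_Icc_self ht₀ab) (Ioo_subset_Icc_self hx)
      simp_rw [heq]
      by_cases hxt : t₀ = x
      · subst hxt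
        simp only [if_true, hG]
        exact (hc.congr fun k => rfl).neg
      · simp only [hxt, if_false, hG, Ne.symm hxt]
        have h1 : Tendsto (fun k => slope (fun t => -F (ψ k) t) t₀ x) atTop
            (𝓝 (slope (fun t => -f t) t₀ x)) := by
          simp only [slope_def_field]
          refine Tendsto.div_const ?_ _
          exact (((hFlim x (hapos.trans hx.1)).comp hψ.tendsto_atTop).neg).sub
            (((hFlim t₀ ht₀).comp hψ.tendsto_atTop).neg)
        convert h1 using 2
        simp only [slope_def_field]
        ring
    exact posSemidef_cfc_sub_cfc_of_tendsto hA hB (fun x hx => hlimpt x (hAab hx))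
      (fun x hx => hlimpt x (hBab hx)) hstep
  -- continuity of `G` at `t₀` (Hansen's Theorem 2.1) gives the derivative
  have hGc : ContinuousAt G t₀ := by
    have h := ((continuousOn_of_isMatrixMonotoneOn_Ioi hGm).continuousAt (Ioi_mem_nhds ht₀)).neg
    refine h.congr (Eventually.of_forall fun t => ?_)
    simp
  refine ⟨c, ?_, hGm⟩
  rw [hasDerivAt_iff_tendsto_slope]
  have h1 : Tendsto G (𝓝[≠] t₀) (𝓝 c) := by
    have := hGc.tendsto.mono_left (nhdsWithin_le_nhds (s := {t₀}ᶜ))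
    simpa [hG] using this
  refine h1.congr' ?_
  filter_upwards [self_mem_nhdsWithin] with t ht
  rw [hG]; dsimp only
  have ht' : t ≠ t₀ := ht
  rw [if_neg ht']

end BendatShermanGeneral

section AutomaticDifferentiability

open MeasureTheory

variable {n : ℕ}

/-- **Automatic differentiability** (Hansen 2013, Corollary 3.8, first half): an operator
monotone function on `(0, ∞)` is differentiable there. [cite: Hansen2013, Corollary 3.8] -/
theorem hasDerivAt_of_isMatrixMonotoneOn_Ioi {f : ℝ → ℝ} (hf : IsMatrixMonotoneOn f (Ioi 0))
    {t : ℝ} (ht : 0 < t) : HasDerivAt f (deriv f t) t := by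
  obtain ⟨c, hc, -⟩ := exists_hasDerivAt_dividedDiff_antitone hf ht
  rwa [hc.deriv]

/-- **Convergence of derivatives** (Hansen 2013, Corollary 3.8, second half): if concave
differentiable `F_k` converge pointwise on `(0, ∞)` to `f`, differentiable at `t > 0`, then
`F_k'(t) → f'(t)` (squeeze between secant slopes). [cite: Hansen2013, Corollary 3.8] -/
theorem tendsto_deriv_of_concave_of_tendsto {F : ℕ → ℝ → ℝ} {f : ℝ → ℝ}
    (hconc : ∀ k, ConcaveOn ℝ (Ioi 0) (F k)) (hdiff : ∀ k x, 0 < x → DifferentiableAt ℝ (F k) x)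
    (hlim : ∀ x, 0 < x → Tendsto (fun k => F k x) atTop (𝓝 (f x))) {t c : ℝ} (ht : 0 < t)
    (hft : HasDerivAt f c t) : Tendsto (fun k => deriv (F k) t) atTop (𝓝 c) := by
  rw [Metric.tendsto_atTop]
  intro δ hδ
  -- secant slopes of `f` near `t` are within `δ/2` of `c`
  have hsl : Tendsto (slope f t) (𝓝[≠] t) (𝓝 c) := hasDerivAt_iff_tendsto_slope.mp hft
  have hev : ∀ᶠ s in 𝓝[≠] t, dist (slope f t s) c < δ / 2 :=
    hsl (Metric.ball_mem_nhds _ (half_pos hδ))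
  rw [eventually_nhdsWithin_iff, Metric.eventually_nhds_iff] at hev
  obtain ⟨r, hr, hrball⟩ := hev
  set h : ℝ := min (r / 2) (t / 2) with hh
  have hhpos : 0 < h := by rw [hh]; exact lt_min (by linarith) (by linarith)
  have hhr : h < r := lt_of_le_of_lt (min_le_left _ _) (by linarith)
  have hht : h < t := lt_of_le_of_lt (min_le_right _ _) (by linarith)
  have hup : dist (slope f t (t + h)) c < δ / 2 :=
    hrball (by rw [dist_eq_norm]; simp [abs_of_pos hhpos, hhr]) (by
      show t + h ∈ ({t}ᶜ : Set ℝ)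
      simp [hhpos.ne'])
  have hdown : dist (slope f t (t - h)) c < δ / 2 :=
    hrball (by rw [dist_eq_norm]; simp [abs_of_pos hhpos, hhr]) (by
      show t - h ∈ ({t}ᶜ : Set ℝ)
      simp [hhpos.ne'])
  -- the approximating slopes converge
  have h1 : Tendsto (fun k => slope (F k) t (t + h)) atTop (𝓝 (slope f t (t + h))) := by
    simp only [slope_def_field]
    exact ((hlim _ (by linarith)).sub (hlim _ ht)).div_const _
  have h2 : Tendsto (fun k => slope (F k) (t - h) t) atTop (𝓝 (slope f (t - h) t)) := by
    simp only [slope_def_field]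
    exact ((hlim _ ht).sub (hlim _ (by linarith))).div_const _
  rw [Metric.tendsto_atTop] at h1 h2
  obtain ⟨N1, hN1⟩ := h1 (δ / 2) (half_pos hδ)
  obtain ⟨N2, hN2⟩ := h2 (δ / 2) (half_pos hδ)
  refine ⟨max N1 N2, fun k hk => ?_⟩
  have hlowk : slope (F k) t (t + h) ≤ deriv (F k) t :=
    (hconc k).slope_le_deriv ht (by show 0 < t + h; linarith) (by linarith) (hdiff k t ht)
  have huppk : deriv (F k) t ≤ slope (F k) (t - h) t :=
    (hconc k).deriv_le_slope (by show 0 < t - h; linarith) ht (by linarith) (hdiff k t ht)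
  have e1 := hN1 k (le_of_max_le_left hk)
  have e2 := hN2 k (le_of_max_le_right hk)
  rw [Real.dist_eq] at e1 e2 hup hdown ⊢
  rw [slope_comm] at hdown
  rw [abs_lt] at e1 e2 hup hdown ⊢
  constructor <;> linarith [e1.1, e1.2, e2.1, e2.2, hup.1, hup.2, hdown.1, hdown.2]

/-- **Positivity of Löwner matrices** (Hansen 2013, Corollary 3.9): the Loewner matrices of an
operator monotone function on `(0, ∞)` (well-defined by automatic differentiability) are positive
semidefinite. [cite: Hansen2013, Corollary 3.9] -/
theorem loewner_matrix_posSemidef_of_isMatrixMonotoneOn_Ioi {f : ℝ → ℝ}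
    (hf : IsMatrixMonotoneOn f (Ioi 0)) (d : Fin n → ℝ) (hd : ∀ i, 0 < d i) :
    (Matrix.of fun i j : Fin n => ((if d i = d j then deriv f (d i)
      else slope f (d j) (d i) : ℝ) : ℂ)).PosSemidef := by
  obtain ⟨F, hFs, hFm, hFlim⟩ := exists_smooth_matrixMonotone_approx hf
  have hF1 : ∀ k x, HasDerivAt (F k) (deriv (F k) x) x := fun k x =>
    (((hFs k).differentiable (by simp)).differentiableAt).hasDerivAt
  have hFc' : ∀ k, Continuous (deriv (F k)) := fun k => (hFs k).continuous_deriv (by simp)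
  -- Loewner matrices of the smooth approximants are positive semidefinite (brick 2)
  have hk : ∀ k, (Matrix.of fun i j : Fin n => ((if d i = d j then deriv (F k) (d i)
      else slope (F k) (d j) (d i) : ℝ) : ℂ)).PosSemidef := by
    intro k
    set b : ℝ := (∑ i, d i) + 1 with hb
    have hdb : ∀ i, d i ∈ Ioo 0 b := fun i =>
      ⟨hd i, by
        have := Finset.single_le_sum (f := d) (fun j _ => (hd j).le) (Finset.mem_univ i)
        rw [hb]; linarith⟩
    exact loewner_matrix_posSemidef_of_monotone (a := 0) (b := b) (fun x _ => hF1 k x)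
      (hFc' k).continuousOn (fun A B hA hB hAs hBs hAB =>
        hFm k n A B hA hB (fun x hx => (hAs hx).1) (fun x hx => (hBs hx).1) hAB) d hdb
  -- entrywise limits
  refine posSemidef_of_tendsto_entry hk fun i j => ?_
  simp only [Matrix.of_apply]
  refine (continuous_ofReal.tendsto _).comp ?_
  by_cases hij : d i = d j
  · simp only [hij, if_true]
    exact tendsto_deriv_of_concave_of_tendsto (fun k => concaveOn_of_isMatrixMonotoneOn_Ioi (hFm k))
      (fun k x _ => (hF1 k x).differentiableAt) hFlim (hd j)
      (hasDerivAt_of_isMatrixMonotoneOn_Ioi hf (hd j))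
  · simp only [hij, if_false, slope_def_field]
    exact ((hFlim _ (hd i)).sub (hFlim _ (hd j))).div_const _

/-- **No stationary points** (Hansen 2013, Corollary 3.10): if an operator monotone function on
`(0, ∞)` has `f'(t) = 0` at some `t > 0` then it is constant; only `2`-monotonicity is used, via
the `2 × 2` Loewner matrix `f'(t) f'(s) ≥ [t, s]_f²`. [cite: Hansen2013, Corollary 3.10] -/
theorem eq_of_deriv_eq_zero_of_isMatrixMonotoneOn_Ioi {f : ℝ → ℝ}
    (hf : IsMatrixMonotoneOn f (Ioi 0)) {t : ℝ} (ht : 0 < t) (h0 : deriv f t = 0) {s : ℝ}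
    (hs : 0 < s) : f s = f t := by
  rcases eq_or_ne s t with rfl | hst
  · rfl
  set d : Fin 2 → ℝ := ![t, s] with hd
  have hdpos : ∀ i, 0 < d i := fun i => by fin_cases i <;> simp [hd, ht, hs]
  have hP := loewner_matrix_posSemidef_of_isMatrixMonotoneOn_Ioi hf d hdpos
  -- the quadratic form at `ξ = (x, 1)` is `f'(t) x² + 2 [t,s] x + f'(s) = 2 [t,s] x + f'(s)`
  have hq : ∀ x : ℝ, 0 ≤ 2 * slope f t s * x + deriv f s := by
    intro x
    have h := hP.dotProduct_mulVec_nonneg ![(x : ℂ), 1]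
    have hts : (if t = s then (0 : ℝ) else slope f s t) = slope f t s := by
      rw [if_neg (Ne.symm hst), slope_comm]
    have hst' : (if s = t then deriv f s else slope f t s : ℝ) = slope f t s := by
      rw [if_neg hst]
    simp only [dotProduct, mulVec, Fin.sum_univ_two, Matrix.of_apply, hd, Matrix.cons_val_zero,
      Matrix.cons_val_one, if_true, h0, hts, hst', Pi.star_apply, RCLike.star_def] at h
    have e : (starRingEnd ℂ) (x : ℂ) * (((0 : ℝ) : ℂ) * (x : ℂ) + ((slope f t s : ℝ) : ℂ) * 1) +
        (starRingEnd ℂ) (1 : ℂ) * (((slope f t s : ℝ) : ℂ) * (x : ℂ) + ((deriv f s : ℝ) : ℂ) * 1) =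
        ((2 * slope f t s * x + deriv f s : ℝ) : ℂ) := by
      simp only [Complex.conj_ofReal, map_one]; push_cast; ring
    rw [e, Complex.zero_le_real] at h
    exact h
  -- hence `[t, s]_f = 0`
  have hsl : slope f t s = 0 := by
    by_contra hne
    have h := hq (-(deriv f s + 1) / (2 * slope f t s))
    rw [mul_div_cancel₀ _ (mul_ne_zero two_ne_zero hne)] at h
    linarith
  rw [slope_def_field, div_eq_zero_iff, sub_eq_zero] at hsl
  rcases hsl with h | h
  · exact h
  · exact absurd h (sub_ne_zero.mpr hst)

end AutomaticDifferentiability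

end Literature.Analysis.Complex
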